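import Mathlib.Algebra.MvPolynomial.Monad
import Mathlib.Topology.Algebra.MvPolynomial
import Mathlib.MeasureTheory.Integral.DominatedConvergence
import Mathlib.MeasureTheory.Integral.Prod
import Mathlib.MeasureTheory.Measure.Lebesgue.EqHaar
import Mathlib.Analysis.SpecialFunctions.Exponential
import Mathlib.Analysis.Complex.Exponential
import Literature.MathematicalPhysics.QuantumLattice.LatticeScalarFieldProofs
import HarnessLib

/-!
# Griffiths–Ginibre correlation inequalities for real-valued lattice spins and the lattice `φ⁴` measure

Sibling proof file of `LatticeScalarField.lean` / `LatticeScalarFieldProofs.lean` (topic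
`Literature/MathematicalPhysics/QuantumLattice`). No statement of the tree is changed and **no
named fact is introduced**: every `def` below is a real definition (a predicate, a polynomial, a
map or a weight) and every inequality is a theorem. This is the first brick of the lattice
`φ⁴` correlation-inequality toolkit needed by the triviality statements constructive-qft.S24
(`phi44_triviality`, `phi4_highDim_triviality` of `QuantumFieldTheory/ContinuumLimits.lean`),
whose printed proofs (Aizenman 1982, §§10–13; Panis 2023, §§3–5) start from the Griffiths
inequalities for the lattice `φ⁴` field (existence and monotonicity of thermodynamic limits of
correlations, positivity of the two-point function, comparison of volumes and couplings).

## Contents (Glimm–Jaffe, *Quantum Physics* (2nd ed. 1987), §4.1–4.2, pp. 55–57)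

* `IsFerromagnetic p` — a real polynomial in the spins with nonnegative coefficients
  ((4.1.3): "ferromagnetic if `0 ≤ J_A`"; Lemma 4.1.2: "ferromagnetic (has positive
  coefficients)"), its closure properties and the estimates `|p(x)| ≤ p(|x|)`, monotonicity on
  the positive orthant; `expPartial N H = ∑_{n<N} Hⁿ/n!`.
* `IsGinibreSystem P Y r w` — Ginibre's abstract setting: a measure `P`, spin coordinates
  `Y : Ω → (σ → ℝ)`, a nonnegative weight `w` and, for each coordinate, a `P`-preserving map
  flipping that coordinate and fixing the others and the weight. **First Griffiths inequality in
  this generality** (`IsGinibreSystem.integral_eval_mul_exp_mul_weight_nonneg`, Thm 4.1.1 with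
  the printed proof: expand `e^{H}` — dominated convergence, hypothesis (4.1.4) — and kill the odd
  monomials by the sign symmetry, `integral_prod_pow_mul_weight_nonneg`).
* Ginibre's duplicate variables (4.1.7): the substitutions `plusSub : ξ_s ↦ (t_s + q_s)/2`,
  `minusSub : χ_s ↦ (t_s − q_s)/2` (we use `t = ξ + χ`, `q = ξ − χ` instead of the rotation by
  `1/√2`, which changes nothing) and **Lemma 4.1.2** (`IsFerromagnetic.isPMPair_plusSub_minusSub`:
  `p(ξ) ± p(χ)` are ferromagnetic in `t, q`), proved through the closure of "plus–minus pairs"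
  under products, `aa' ± bb' = ½[(a+b)(a'±b') + (a−b)(a'∓b')]`.
* Real lattice spins `φ : V → ℝ` with **even single-site potentials** `U_x` dominating
  Gaussians (`IsEvenSitePotential`; a priori measure `∏ₓ e^{−U_x(φ_x)} dφ_x`) and a
  ferromagnetic interaction polynomial `H` of quadratic growth (`HasQuadraticGrowth`; pair
  interactions and external fields), Boltzmann weight `boltzWeight U H = e^{H} ∏ e^{−U_x}`:
  - `isGinibreSystem_single` (spin reflections `φ_s ↦ −φ_s` preserve Lebesgue measure and the
    even weight) and **`griffiths_first`** (Thm 4.1.1): `0 ≤ ∫ p e^{H} ∏ e^{−U}` for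
    ferromagnetic `p`;
  - `isGinibreSystem_double` (Thm 4.1.3, (4.1.13): on the doubled lattice the exchange
    `(ξ_s, χ_s) ↦ (χ_s, ξ_s)`, i.e. `q_s ↦ −q_s`, and the exchange-and-negate
    `(ξ_s, χ_s) ↦ (−χ_s, −ξ_s)`, i.e. `t_s ↦ −t_s`, are linear involutions — determinant `±1`,
    `measurePreserving_linear_of_comp_self` — fixing the doubled even weight) and
    **`griffiths_second`** (Thm 4.1.3, (4.1.11)): `(∫ p B)(∫ q B) ≤ (∫ pq B)(∫ B)` for
    ferromagnetic `p`, `q`, via `2[⟨pq⟩ − ⟨p⟩⟨q⟩] = ⟨⟨(p(ξ) − p(χ))(q(ξ) − q(χ))⟩⟩ ≥ 0`;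
  - **`griffiths_mono`** (Prop. 4.2.1, monotonicity in the couplings, in the derivative-free
    form `⟨p⟩_H ≤ ⟨p⟩_{H+D}` for ferromagnetic `D`): the second inequality for `p` and
    `expPartial N D`, and dominated convergence.
* The lattice `φ⁴` measure `phi4Measure G g κ J` of `LatticeScalarField` (`g > 0`, `J ≥ 0`;
  `U_x(u) = g u⁴ + κ u²`, `H = J · pairPoly G`, `boltzWeight_phi4 : B = e^{−phi4Action}`):
  `integral_eval_phi4Measure_nonneg` (GKS I), `griffiths_second_phi4Measure` (GKS II),
  `integral_eval_phi4Measure_mono` (monotone in `J`), their moment forms `phi4_moment_nonneg`,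
  `phi4_moment_griffiths_second`, `phi4_moment_mono`, the two-point forms `phi4_twoPoint_nonneg`,
  `phi4_twoPoint_mono`, `phi4_twoPoint_mul_twoPoint_le`, and for the free-boundary volumes on
  `ℤᵈ`: `phi4TwoPointIn_nonneg`, `phi4TwoPointIn_mono` (`phi4TwoPointIn d Λ g κ J x y ≥ 0` and
  nondecreasing in `J ≥ 0`).

## Sources

* J. Glimm, A. Jaffe, *Quantum Physics: a functional integral point of view*, 2nd ed.
  (Springer 1987), §4.1 "Griffiths inequalities": (4.1.3)–(4.1.8), Thm 4.1.1, Lemma 4.1.2,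
  Thm 4.1.3 (pp. 55–57); §4.2, Prop. 4.2.1–4.2.2 (p. 57) [GlimmJaffeQP1987] (held; read pp. 55–57).
* J. Ginibre, *General formulation of Griffiths' inequalities*, Comm. Math. Phys. 16 (1970)
  310–328 [Ginibre1970] — the duplicate-variable method, as presented by Glimm–Jaffe.

## Design

* The sign convention is `e^{+H}` with `H` ferromagnetic (Glimm–Jaffe write `e^{−H}`,
  `H = −∑ J_A ξ^A`); the single-site potentials `U_x` are kept outside `H`, as the a priori
  measures `dμ_x` of (4.1.5).
* Hypothesis (4.1.4), `∫ |ξ|^N e^{|H(ξ)|} dμ < ∞`, is derived (not assumed) for the class used by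
  the tree: `U_x` dominating every Gaussian (`∫ e^{a u²} e^{−U_x(u)} du < ∞` for all `a`) and `H`
  of quadratic growth on the positive orthant; monomials are absorbed by
  `|u|ⁿ ≤ e^{n u²}` (`abs_pow_le_exp_mul_sq`). The abstract core
  (`IsGinibreSystem.integral_eval_mul_exp_mul_weight_nonneg`) keeps (4.1.4) as a hypothesis.
* No change of variables is performed on the doubled measure: the doubled Lebesgue measure with
  the weight `e^{−∑(U(ξ_x)+U(χ_x))}` is shown invariant under the exchange / exchange-and-negate
  maps directly (linear involutions), and only the *observables* are rewritten in `t, q`.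
* Not here (next bricks): monotonicity in the volume for the free-boundary `φ⁴` measures on
  `ℤᵈ` (needs edge-dependent couplings: use `griffiths_mono` with `H = ∑_e J_e X X`), the
  thermodynamic limit of `phi4TwoPointIn`, Lebowitz / GHS / Gaussian-domination inequalities.

## Mathlib

`MvPolynomial` (`eval_eq'`, `coeff_mul`, `bind₁`, `eval₂Hom_bind₁`, `continuous_eval`),
`Measure.map_linearMap_addHaar_eq_smul_addHaar`, `LinearMap.det_comp`,
`Measure.prod.instIsAddHaarMeasure`, `integral_prod_mul`, `Integrable.mul_prod`,
`Integrable.fintype_prod`, `tendsto_integral_of_dominated_convergence`,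
`NormedSpace.expSeries_div_hasSum_exp`, `Real.sum_le_exp_of_nonneg`, `integral_tilted`,
`integral_exp_pos`. From the tree: `phi4Action`, `phi4Measure`, `pairInteraction`,
`abs_pairInteraction_le`, `neg_mul_sq_add_mul_le`, `integrable_exp_neg_phi4Action`
(`LatticeScalarFieldProofs`), `phi4TwoPointIn`, `phi4FreeMeasure`, `glueZero`, `zdGraphIn`
(`LatticeScalarField`).
-/

noncomputable section

open MeasureTheory Filter Topology Finset MvPolynomial

namespace Literature.MathematicalPhysics.QuantumLattice

/-! ### Ferromagnetic polynomials (all coefficients nonnegative) -/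

section Ferromagnetic

variable {σ : Type*}

/-- A real polynomial in the spin variables `(X s)_{s ∈ σ}` is *ferromagnetic* if all its
coefficients are nonnegative (Glimm–Jaffe 1987, §4.1, (4.1.3): "`H = -∑_A J_A ξ^A` is said to be
ferromagnetic if `0 ≤ J_A` for all `A`"; Lemma 4.1.2: "ferromagnetic (has positive coefficients)
as a polynomial in `q` and `t`"). [cite: GlimmJaffeQP1987, §4.1 (4.1.3) and Lemma 4.1.2] -/
def IsFerromagnetic (p : MvPolynomial σ ℝ) : Prop :=
  ∀ m, 0 ≤ p.coeff m

namespace IsFerromagnetic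

/-- `0` is ferromagnetic. [folklore] -/
theorem zero : IsFerromagnetic (0 : MvPolynomial σ ℝ) := fun m => by simp

/-- Nonnegative constants are ferromagnetic. [folklore] -/
theorem C {c : ℝ} (hc : 0 ≤ c) : IsFerromagnetic (C c : MvPolynomial σ ℝ) := fun m => by
  classical
  rw [coeff_C]
  split_ifs <;> simp [hc]

/-- `1` is ferromagnetic. [folklore] -/
theorem one : IsFerromagnetic (1 : MvPolynomial σ ℝ) := by
  simpa using (C (σ := σ) zero_le_one)

/-- The spin variables are ferromagnetic. [folklore] -/
theorem X (s : σ) : IsFerromagnetic (X s : MvPolynomial σ ℝ) := fun m => by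
  classical
  rw [coeff_X]
  split_ifs <;> simp

/-- Monomials with nonnegative coefficient are ferromagnetic. [folklore] -/
theorem monomial (d : σ →₀ ℕ) {c : ℝ} (hc : 0 ≤ c) : IsFerromagnetic (monomial d c) := fun m => by
  classical
  rw [coeff_monomial]
  split_ifs <;> simp [hc]

variable {p q : MvPolynomial σ ℝ}

/-- Sums of ferromagnetic polynomials are ferromagnetic. [folklore] -/
theorem add (hp : IsFerromagnetic p) (hq : IsFerromagnetic q) : IsFerromagnetic (p + q) :=
  fun m => by rw [coeff_add]; exact add_nonneg (hp m) (hq m)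

/-- Products of ferromagnetic polynomials are ferromagnetic (Cauchy product of nonnegative
coefficients). [folklore] -/
theorem mul (hp : IsFerromagnetic p) (hq : IsFerromagnetic q) : IsFerromagnetic (p * q) :=
  fun m => by
    classical
    rw [coeff_mul]
    exact Finset.sum_nonneg fun x _ => mul_nonneg (hp _) (hq _)

/-- Nonnegative multiples of ferromagnetic polynomials are ferromagnetic. [folklore] -/
theorem smul {c : ℝ} (hc : 0 ≤ c) (hp : IsFerromagnetic p) : IsFerromagnetic (c • p) :=
  fun m => by rw [coeff_smul]; exact mul_nonneg hc (hp m)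

/-- Finite sums of ferromagnetic polynomials are ferromagnetic. [folklore] -/
theorem sum {ι : Type*} (s : Finset ι) {f : ι → MvPolynomial σ ℝ}
    (hf : ∀ i ∈ s, IsFerromagnetic (f i)) : IsFerromagnetic (∑ i ∈ s, f i) := by
  classical
  induction s using Finset.induction_on with
  | empty => simpa using zero
  | insert a s ha ih =>
    rw [Finset.sum_insert ha]
    exact (hf a (Finset.mem_insert_self a s)).add (ih fun i hi => hf i (Finset.mem_insert_of_mem hi))

/-- Finite products of ferromagnetic polynomials are ferromagnetic. [folklore] -/
theorem prod {ι : Type*} (s : Finset ι) {f : ι → MvPolynomial σ ℝ}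
    (hf : ∀ i ∈ s, IsFerromagnetic (f i)) : IsFerromagnetic (∏ i ∈ s, f i) := by
  classical
  induction s using Finset.induction_on with
  | empty => simpa using one
  | insert a s ha ih =>
    rw [Finset.prod_insert ha]
    exact (hf a (Finset.mem_insert_self a s)).mul (ih fun i hi => hf i (Finset.mem_insert_of_mem hi))

/-- Powers of ferromagnetic polynomials are ferromagnetic. [folklore] -/
theorem pow (hp : IsFerromagnetic p) (n : ℕ) : IsFerromagnetic (p ^ n) := by
  induction n with
  | zero => simpa using one
  | succ n ih => rw [pow_succ]; exact ih.mul hp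

/-- If `2p` is ferromagnetic then so is `p`. [folklore] -/
theorem of_two_mul (hp : IsFerromagnetic (2 * p)) : IsFerromagnetic p := fun m => by
  have h := hp m
  rw [show (2 : MvPolynomial σ ℝ) = MvPolynomial.C 2 from (map_ofNat _ 2).symm, coeff_C_mul] at h
  linarith

/-- A ferromagnetic polynomial is nonnegative on the nonnegative orthant. [folklore] -/
theorem eval_nonneg [Fintype σ] (hp : IsFerromagnetic p) {x : σ → ℝ} (hx : ∀ s, 0 ≤ x s) :
    0 ≤ eval x p := by
  rw [eval_eq']
  exact Finset.sum_nonneg fun d _ =>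
    mul_nonneg (hp d) (Finset.prod_nonneg fun i _ => pow_nonneg (hx i) _)

/-- `|p(x)| ≤ p(|x|)` for a ferromagnetic polynomial. [folklore] -/
theorem abs_eval_le [Fintype σ] (hp : IsFerromagnetic p) (x : σ → ℝ) :
    |eval x p| ≤ eval (fun s => |x s|) p := by
  rw [eval_eq', eval_eq']
  refine (Finset.abs_sum_le_sum_abs _ _).trans (le_of_eq (Finset.sum_congr rfl fun d _ => ?_))
  rw [abs_mul, abs_of_nonneg (hp d), Finset.abs_prod]
  simp [abs_pow]

/-- A ferromagnetic polynomial is monotone on the nonnegative orthant. [folklore] -/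
theorem eval_mono [Fintype σ] (hp : IsFerromagnetic p) {x y : σ → ℝ} (hx : ∀ s, 0 ≤ x s)
    (hxy : ∀ s, x s ≤ y s) : eval x p ≤ eval y p := by
  rw [eval_eq', eval_eq']
  refine Finset.sum_le_sum fun d _ => mul_le_mul_of_nonneg_left ?_ (hp d)
  exact Finset.prod_le_prod (fun i _ => pow_nonneg (hx i) _)
    fun i _ => pow_le_pow_left₀ (hx i) (hxy i) _

end IsFerromagnetic

/-- The truncated exponential series `∑_{n < N} H^n / n!` of a polynomial. [folklore] -/
def expPartial (N : ℕ) (H : MvPolynomial σ ℝ) : MvPolynomial σ ℝ :=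
  ∑ n ∈ Finset.range N, ((n.factorial : ℝ)⁻¹) • H ^ n

/-- Truncated exponentials of a ferromagnetic polynomial are ferromagnetic. [folklore] -/
theorem IsFerromagnetic.expPartial {H : MvPolynomial σ ℝ} (hH : IsFerromagnetic H) (N : ℕ) :
    IsFerromagnetic (expPartial N H) :=
  IsFerromagnetic.sum _ fun n _ => (hH.pow n).smul (by positivity)

/-- Evaluation of the truncated exponential series. [folklore] -/
theorem eval_expPartial (x : σ → ℝ) (N : ℕ) (H : MvPolynomial σ ℝ) :
    eval x (expPartial N H) = ∑ n ∈ Finset.range N, (eval x H) ^ n / (n.factorial : ℝ) := by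
  simp only [expPartial, map_sum, smul_eval, map_pow]
  exact Finset.sum_congr rfl fun n _ => by rw [div_eq_inv_mul]

end Ferromagnetic

/-! ### Ginibre systems: sign-symmetric a priori measures and the first Griffiths inequality -/

section Core

variable {Ω : Type*} [MeasurableSpace Ω] {σ : Type*} [Fintype σ]

/-- **Ginibre's abstract setting for the Griffiths inequalities.** A measure `P` on a measurable
space `Ω`, real "spin coordinates" `Y ω : σ → ℝ` (jointly measurable), a nonnegative measurable
weight `w` and, for every coordinate `s`, a `P`-preserving map `r s : Ω → Ω` which flips the sign
of the coordinate `s`, fixes all other coordinates and fixes the weight. Instances: the single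
lattice (`Ω = σ → ℝ`, Lebesgue measure, `r s` = reflection of the `s`-th coordinate, `w` = the
product of even single-spin densities; Glimm–Jaffe 1987, Thm 4.1.1) and Ginibre's doubled lattice
in the rotated coordinates `t = ξ + χ`, `q = ξ − χ` (`r` = exchange, resp. exchange-and-negate, of
`ξ_s` and `χ_s`; Glimm–Jaffe 1987, (4.1.7) and (4.1.13)). [cite: GlimmJaffeQP1987, §4.1 Thm 4.1.1 and (4.1.13) (pp. 55–57)] -/
structure IsGinibreSystem (P : Measure Ω) (Y : Ω → σ → ℝ) (r : σ → Ω → Ω) (w : Ω → ℝ) : Prop where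
  measurable : Measurable Y
  measurePreserving : ∀ s, MeasurePreserving (r s) P P
  apply_flip : ∀ s ω, Y (r s ω) s = -Y ω s
  apply_of_ne : ∀ s t, t ≠ s → ∀ ω, Y (r s ω) t = Y ω t
  measurable_weight : Measurable w
  weight_nonneg : ∀ ω, 0 ≤ w ω
  weight_flip : ∀ s ω, w (r s ω) = w ω

namespace IsGinibreSystem

variable {P : Measure Ω} {Y : Ω → σ → ℝ} {r : σ → Ω → Ω} {w : Ω → ℝ}

omit [Fintype σ] in
/-- Each spin coordinate of a Ginibre system is measurable. [folklore] -/
theorem measurable_apply (h : IsGinibreSystem P Y r w) (s : σ) : Measurable fun ω => Y ω s :=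
  (measurable_pi_apply s).comp h.measurable

/-- Monomials in the spin coordinates are measurable. [folklore] -/
theorem measurable_prod_pow (h : IsGinibreSystem P Y r w) (m : σ →₀ ℕ) :
    Measurable fun ω => ∏ s, Y ω s ^ m s :=
  Finset.measurable_prod _ fun s _ => (h.measurable_apply s).pow_const _

/-- Polynomials in the spin coordinates are measurable. [folklore] -/
theorem measurable_eval (h : IsGinibreSystem P Y r w) (p : MvPolynomial σ ℝ) :
    Measurable fun ω => eval (Y ω) p :=
  (MvPolynomial.continuous_eval p).measurable.comp h.measurable

/-- Under the flip `r s`, a monomial picks up the sign `(-1)^{m s}`. [folklore] -/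
theorem prod_pow_flip (h : IsGinibreSystem P Y r w) (s : σ) (m : σ →₀ ℕ) (ω : Ω) :
    ∏ t, Y (r s ω) t ^ m t = (-1) ^ m s * ∏ t, Y ω t ^ m t := by
  classical
  have hterm : ∀ t, Y (r s ω) t ^ m t =
      (if t = s then (-1 : ℝ) ^ m t else 1) * Y ω t ^ m t := by
    intro t
    by_cases hts : t = s
    · subst hts
      rw [if_pos rfl, h.apply_flip, neg_eq_neg_one_mul, mul_pow]
    · rw [if_neg hts, one_mul, h.apply_of_ne s t hts]
  simp_rw [hterm]
  rw [Finset.prod_mul_distrib, Finset.prod_ite_eq' Finset.univ s (fun t => (-1 : ℝ) ^ m t)]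
  simp

/-- **Sign symmetry kills odd monomials**: `∫ Y^m w dP = 0` unless every exponent is even, and then
the integrand is nonnegative; in either case `0 ≤ ∫ Y^m w dP` (Glimm–Jaffe 1987, proof of
Thm 4.1.1: "either zero (for `C_i` an odd integer) or positive (for `C_i` an even integer)").
[cite: GlimmJaffeQP1987, Thm 4.1.1 (proof, p. 56)] -/
theorem integral_prod_pow_mul_weight_nonneg (h : IsGinibreSystem P Y r w) (m : σ →₀ ℕ) :
    0 ≤ ∫ ω, (∏ s, Y ω s ^ m s) * w ω ∂P := by
  by_cases heven : ∀ s, Even (m s)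
  · exact integral_nonneg fun ω =>
      mul_nonneg (Finset.prod_nonneg fun s _ => (heven s).pow_nonneg _) (h.weight_nonneg ω)
  · push Not at heven
    obtain ⟨s, hs⟩ := heven
    rw [Nat.not_even_iff_odd] at hs
    set F : Ω → ℝ := fun ω => (∏ t, Y ω t ^ m t) * w ω with hF
    have hFm : Measurable F := (h.measurable_prod_pow m).mul h.measurable_weight
    have hflip : ∀ ω, F (r s ω) = -F ω := fun ω => by
      simp only [hF, h.prod_pow_flip s m ω, h.weight_flip s ω, hs.neg_one_pow]
      ring
    have hint : ∫ ω, F ω ∂P = ∫ ω, F (r s ω) ∂P := by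
      conv_lhs => rw [← (h.measurePreserving s).map_eq]
      exact integral_map (h.measurePreserving s).measurable.aemeasurable hFm.aestronglyMeasurable
    have h2 : ∫ ω, F (r s ω) ∂P = -∫ ω, F ω ∂P := by
      simp_rw [hflip]
      exact integral_neg F
    have hzero : ∫ ω, F ω ∂P = 0 := by linarith
    exact hzero.symm.le

/-- Integral of a ferromagnetic polynomial in the spin coordinates against the symmetric weight is
nonnegative (finite-sum version of Glimm–Jaffe 1987, Thm 4.1.1). [cite: GlimmJaffeQP1987, Thm 4.1.1 (p. 56)] -/
theorem integral_eval_mul_weight_nonneg (h : IsGinibreSystem P Y r w) {p : MvPolynomial σ ℝ}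
    (hp : IsFerromagnetic p)
    (hint : ∀ m ∈ p.support, Integrable (fun ω => (∏ s, Y ω s ^ m s) * w ω) P) :
    0 ≤ ∫ ω, eval (Y ω) p * w ω ∂P := by
  have hexp : ∀ ω, eval (Y ω) p * w ω =
      ∑ m ∈ p.support, p.coeff m * ((∏ s, Y ω s ^ m s) * w ω) := fun ω => by
    rw [eval_eq', Finset.sum_mul]
    exact Finset.sum_congr rfl fun m _ => by ring
  simp_rw [hexp]
  rw [integral_finsetSum _ fun m hm => (hint m hm).const_mul _]
  exact Finset.sum_nonneg fun m hm => by
    rw [integral_const_mul]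
    exact mul_nonneg (hp m) (h.integral_prod_pow_mul_weight_nonneg m)

omit [MeasurableSpace Ω] [Fintype σ] in
/-- Pointwise convergence of the truncated exponential weights:
`p(Y) · (∑_{n<N} H(Y)^n/n!) · w → p(Y) e^{H(Y)} w`. [folklore] -/
theorem tendsto_eval_mul_expPartial (Y : Ω → σ → ℝ) (w : Ω → ℝ) (p H : MvPolynomial σ ℝ)
    (ω : Ω) :
    Tendsto (fun N => eval (Y ω) (p * expPartial N H) * w ω) atTop
      (𝓝 (eval (Y ω) p * Real.exp (eval (Y ω) H) * w ω)) := by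
  have hexp : Tendsto (fun N => ∑ n ∈ Finset.range N, (eval (Y ω) H) ^ n / (n.factorial : ℝ)) atTop
      (𝓝 (Real.exp (eval (Y ω) H))) := by
    rw [Real.exp_eq_exp_ℝ]
    exact (NormedSpace.expSeries_div_hasSum_exp (eval (Y ω) H)).tendsto_sum_nat
  simp_rw [map_mul, eval_expPartial]
  exact (hexp.const_mul _).mul_const _

omit [MeasurableSpace Ω] in
/-- Domination of the truncated exponential weights:
`|p(Y) · (∑_{n<N} H(Y)^n/n!) · w| ≤ p(|Y|) e^{H(|Y|)} w` for ferromagnetic `p`, `H` and `w ≥ 0`.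
[folklore] -/
theorem norm_eval_mul_expPartial_le {Y : Ω → σ → ℝ} {w : Ω → ℝ} (hw : ∀ ω, 0 ≤ w ω)
    {p H : MvPolynomial σ ℝ} (hp : IsFerromagnetic p) (hH : IsFerromagnetic H) (N : ℕ) (ω : Ω) :
    ‖eval (Y ω) (p * expPartial N H) * w ω‖ ≤
      eval (fun s => |Y ω s|) p * Real.exp (eval (fun s => |Y ω s|) H) * w ω := by
  rw [Real.norm_eq_abs, abs_mul, abs_of_nonneg (hw ω), map_mul, abs_mul]
  refine mul_le_mul_of_nonneg_right ?_ (hw ω)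
  refine mul_le_mul (hp.abs_eval_le _) ?_ (abs_nonneg _)
    ((abs_nonneg _).trans (hp.abs_eval_le _))
  rw [eval_expPartial]
  calc |∑ n ∈ Finset.range N, eval (Y ω) H ^ n / (n.factorial : ℝ)|
      ≤ ∑ n ∈ Finset.range N, |eval (Y ω) H| ^ n / (n.factorial : ℝ) := by
        refine (Finset.abs_sum_le_sum_abs _ _).trans (le_of_eq (Finset.sum_congr rfl fun n _ => ?_))
        rw [abs_div, abs_pow, Nat.abs_cast]
    _ ≤ Real.exp |eval (Y ω) H| := Real.sum_le_exp_of_nonneg (abs_nonneg _) N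
    _ ≤ Real.exp (eval (fun s => |Y ω s|) H) := Real.exp_le_exp.2 (hH.abs_eval_le _)

/-- **Dominated convergence for the exponential series of a ferromagnetic interaction**
(Glimm–Jaffe 1987, proof of Thm 4.1.1: "By (4.1.4), the sum and integral can be interchanged"):
if `p(|Y|) e^{H(|Y|)} w` is integrable then
`∫ p(Y) (∑_{n<N} H(Y)^n/n!) w dP → ∫ p(Y) e^{H(Y)} w dP`. [cite: GlimmJaffeQP1987, Thm 4.1.1 (proof, p. 56) and (4.1.4)] -/
theorem tendsto_integral_eval_mul_expPartial {P : Measure Ω} {Y : Ω → σ → ℝ} (hY : Measurable Y)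
    {w : Ω → ℝ} (hwm : Measurable w) (hw : ∀ ω, 0 ≤ w ω) {p H : MvPolynomial σ ℝ}
    (hp : IsFerromagnetic p) (hH : IsFerromagnetic H)
    (hdom : Integrable (fun ω => eval (fun s => |Y ω s|) p *
      Real.exp (eval (fun s => |Y ω s|) H) * w ω) P) :
    Tendsto (fun N => ∫ ω, eval (Y ω) (p * expPartial N H) * w ω ∂P) atTop
      (𝓝 (∫ ω, eval (Y ω) p * Real.exp (eval (Y ω) H) * w ω ∂P)) := by
  refine tendsto_integral_of_dominated_convergence _ (fun N => ?_) hdom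
    (fun N => Eventually.of_forall fun ω => norm_eval_mul_expPartial_le hw hp hH N ω)
    (Eventually.of_forall fun ω => tendsto_eval_mul_expPartial Y w p H ω)
  exact (((MvPolynomial.continuous_eval _).measurable.comp hY).mul hwm).aestronglyMeasurable

/-- **First Griffiths inequality in Ginibre's generality** (Glimm–Jaffe 1987, Thm 4.1.1, with the
monomial `ξ^A` replaced by any ferromagnetic polynomial `p`): in a Ginibre system, for
ferromagnetic `p` and `H`, `0 ≤ ∫ p(Y) e^{H(Y)} w dP`, granted the integrability (4.1.4) of
`|Y|^m e^{H(|Y|)} w` for all exponents `m`. Proof as printed: expand `e^{H}` (dominated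
convergence, `tendsto_integral_eval_mul_expPartial`); each term is a ferromagnetic polynomial,
whose integral is a nonnegative combination of integrals of monomials, each of which vanishes by
the sign symmetry unless all exponents are even (`integral_prod_pow_mul_weight_nonneg`).
[cite: GlimmJaffeQP1987, Thm 4.1.1 (p. 56)] -/
theorem integral_eval_mul_exp_mul_weight_nonneg (h : IsGinibreSystem P Y r w)
    {p H : MvPolynomial σ ℝ} (hp : IsFerromagnetic p) (hH : IsFerromagnetic H)
    (hint : ∀ m : σ →₀ ℕ, Integrable (fun ω => (∏ s, |Y ω s| ^ m s) *
      Real.exp (eval (fun s => |Y ω s|) H) * w ω) P) :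
    0 ≤ ∫ ω, eval (Y ω) p * Real.exp (eval (Y ω) H) * w ω ∂P := by
  -- integrability of every monomial against the weight (the exponential factor is `≥ 1`)
  have hmono : ∀ m : σ →₀ ℕ, Integrable (fun ω => (∏ s, Y ω s ^ m s) * w ω) P := by
    intro m
    refine (hint m).mono' ((h.measurable_prod_pow m).mul h.measurable_weight).aestronglyMeasurable
      (Eventually.of_forall fun ω => ?_)
    rw [Real.norm_eq_abs, abs_mul, abs_of_nonneg (h.weight_nonneg ω), Finset.abs_prod]
    simp_rw [abs_pow]
    refine mul_le_mul_of_nonneg_right ?_ (h.weight_nonneg ω)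
    refine le_mul_of_one_le_right (Finset.prod_nonneg fun s _ => pow_nonneg (abs_nonneg _) _) ?_
    exact Real.one_le_exp (hH.eval_nonneg fun s => abs_nonneg _)
  -- the dominating function is a finite combination of the `hint m`
  have hdom : Integrable (fun ω => eval (fun s => |Y ω s|) p *
      Real.exp (eval (fun s => |Y ω s|) H) * w ω) P := by
    have heq : (fun ω => eval (fun s => |Y ω s|) p * Real.exp (eval (fun s => |Y ω s|) H) * w ω) =
        fun ω => ∑ m ∈ p.support, p.coeff m *
          ((∏ s, |Y ω s| ^ m s) * Real.exp (eval (fun s => |Y ω s|) H) * w ω) := by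
      funext ω
      rw [eval_eq', Finset.sum_mul, Finset.sum_mul]
      exact Finset.sum_congr rfl fun m _ => by ring
    rw [heq]
    exact integrable_finsetSum _ fun m _ => (hint m).const_mul _
  refine ge_of_tendsto' (tendsto_integral_eval_mul_expPartial h.measurable h.measurable_weight
    h.weight_nonneg hp hH hdom) fun N => ?_
  exact h.integral_eval_mul_weight_nonneg (hp.mul (hH.expPartial N)) fun m _ => hmono m

end IsGinibreSystem

end Core

/-! ### Ginibre's duplicate variables: Glimm–Jaffe's Lemma 4.1.2 -/

section Doubling

variable {σ : Type*}

/-- The substitution `ξ_s ↦ (t_s + q_s)/2` into the duplicated variables `t_s = X (inl s)`,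
`q_s = X (inr s)` (Glimm–Jaffe 1987, (4.1.7'), with the normalisation `t = ξ + χ`, `q = ξ − χ`
instead of the rotation by `1/√2`). [cite: GlimmJaffeQP1987, §4.1 (4.1.7)] -/
def plusSub : MvPolynomial σ ℝ →ₐ[ℝ] MvPolynomial (σ ⊕ σ) ℝ :=
  bind₁ fun s => C (1 / 2 : ℝ) * (X (Sum.inl s) + X (Sum.inr s))

/-- The substitution `χ_s ↦ (t_s − q_s)/2` (Glimm–Jaffe 1987, (4.1.7')). [cite: GlimmJaffeQP1987, §4.1 (4.1.7)] -/
def minusSub : MvPolynomial σ ℝ →ₐ[ℝ] MvPolynomial (σ ⊕ σ) ℝ :=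
  bind₁ fun s => C (1 / 2 : ℝ) * (X (Sum.inl s) - X (Sum.inr s))

/-- `plusSub` on a generator. [cite: GlimmJaffeQP1987, §4.1 (4.1.7') (p. 56)] -/
theorem plusSub_X (s : σ) :
    plusSub (X s : MvPolynomial σ ℝ) = C (1 / 2 : ℝ) * (X (Sum.inl s) + X (Sum.inr s)) :=
  bind₁_X_right _ _

/-- `minusSub` on a generator. [cite: GlimmJaffeQP1987, §4.1 (4.1.7') (p. 56)] -/
theorem minusSub_X (s : σ) :
    minusSub (X s : MvPolynomial σ ℝ) = C (1 / 2 : ℝ) * (X (Sum.inl s) - X (Sum.inr s)) :=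
  bind₁_X_right _ _

/-- In the duplicated coordinates `t = ξ + χ`, `q = ξ − χ`, the substitution `plusSub` evaluates
to the first copy `ξ`. [cite: GlimmJaffeQP1987, §4.1 (4.1.7)] -/
theorem eval_plusSub [Fintype σ] (x y : σ → ℝ) (p : MvPolynomial σ ℝ) :
    eval (Sum.elim (x + y) (x - y)) (plusSub p) = eval x p := by
  change eval₂Hom (RingHom.id ℝ) _ (bind₁ _ p) = _
  rw [eval₂Hom_bind₁]
  change eval (fun s => eval (Sum.elim (x + y) (x - y))
    (C (1 / 2 : ℝ) * (X (Sum.inl s) + X (Sum.inr s)))) p = eval x p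
  have key : (fun s => eval (Sum.elim (x + y) (x - y))
      (C (1 / 2 : ℝ) * (X (Sum.inl s) + X (Sum.inr s)) : MvPolynomial (σ ⊕ σ) ℝ)) = x := by
    funext s
    simp only [map_mul, eval_C, map_add, eval_X, Sum.elim_inl, Sum.elim_inr, Pi.add_apply,
      Pi.sub_apply]
    ring
  rw [key]

/-- In the duplicated coordinates `t = ξ + χ`, `q = ξ − χ`, the substitution `minusSub` evaluates
to the second copy `χ`. [cite: GlimmJaffeQP1987, §4.1 (4.1.7)] -/
theorem eval_minusSub [Fintype σ] (x y : σ → ℝ) (p : MvPolynomial σ ℝ) :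
    eval (Sum.elim (x + y) (x - y)) (minusSub p) = eval y p := by
  change eval₂Hom (RingHom.id ℝ) _ (bind₁ _ p) = _
  rw [eval₂Hom_bind₁]
  change eval (fun s => eval (Sum.elim (x + y) (x - y))
    (C (1 / 2 : ℝ) * (X (Sum.inl s) - X (Sum.inr s)))) p = eval y p
  have key : (fun s => eval (Sum.elim (x + y) (x - y))
      (C (1 / 2 : ℝ) * (X (Sum.inl s) - X (Sum.inr s)) : MvPolynomial (σ ⊕ σ) ℝ)) = y := by
    funext s
    simp only [map_mul, eval_C, map_sub, eval_X, Sum.elim_inl, Sum.elim_inr, Pi.add_apply,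
      Pi.sub_apply]
    ring
  rw [key]

variable {τ : Type*}

/-- Glimm–Jaffe's property of a pair `(a, b)` of polynomials in the duplicated variables: both
`a + b` and `a − b` are ferromagnetic (Lemma 4.1.2 asserts it for `a = ξ^A`, `b = χ^A` written in
the variables `t, q`). [cite: GlimmJaffeQP1987, Lemma 4.1.2 (p. 56)] -/
def IsPMPair (a b : MvPolynomial τ ℝ) : Prop :=
  IsFerromagnetic (a + b) ∧ IsFerromagnetic (a - b)

namespace IsPMPair

variable {a b a' b' : MvPolynomial τ ℝ}

/-- `(1, 1)` is a plus–minus pair. [folklore] -/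
theorem one : IsPMPair (1 : MvPolynomial τ ℝ) 1 :=
  ⟨IsFerromagnetic.one.add IsFerromagnetic.one, by simpa using IsFerromagnetic.zero⟩

/-- Plus–minus pairs are closed under addition. [folklore] -/
theorem add (h : IsPMPair a b) (h' : IsPMPair a' b') : IsPMPair (a + a') (b + b') := by
  refine ⟨?_, ?_⟩
  · have := h.1.add h'.1
    convert this using 1
    ring
  · have := h.2.add h'.2
    convert this using 1
    ring

/-- The key algebraic step: products of plus–minus pairs are plus–minus pairs, since
`aa' + bb' = ½[(a+b)(a'+b') + (a−b)(a'−b')]` and `aa' − bb' = ½[(a+b)(a'−b') + (a−b)(a'+b')]`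
(Glimm–Jaffe 1987, proof of Lemma 4.1.2: "the terms with opposite sign cancel, and the terms with
the same sign are ferromagnetic"). [cite: GlimmJaffeQP1987, Lemma 4.1.2 (proof, p. 56)] -/
theorem mul (h : IsPMPair a b) (h' : IsPMPair a' b') : IsPMPair (a * a') (b * b') := by
  refine ⟨IsFerromagnetic.of_two_mul ?_, IsFerromagnetic.of_two_mul ?_⟩
  · have key : 2 * (a * a' + b * b') = (a + b) * (a' + b') + (a - b) * (a' - b') := by ring
    rw [key]
    exact (h.1.mul h'.1).add (h.2.mul h'.2)
  · have key : 2 * (a * a' - b * b') = (a + b) * (a' - b') + (a - b) * (a' + b') := by ring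
    rw [key]
    exact (h.1.mul h'.2).add (h.2.mul h'.1)

/-- Plus–minus pairs are closed under nonnegative scalars. [folklore] -/
theorem C_mul (h : IsPMPair a b) {c : ℝ} (hc : 0 ≤ c) : IsPMPair (C c * a) (C c * b) := by
  refine ⟨?_, ?_⟩
  · rw [← mul_add, C_mul']
    exact h.1.smul hc
  · rw [← mul_sub, C_mul']
    exact h.2.smul hc

/-- Plus–minus pairs are closed under powers. [cite: GlimmJaffeQP1987, Lemma 4.1.2 (p. 56)] -/
theorem pow (h : IsPMPair a b) (n : ℕ) : IsPMPair (a ^ n) (b ^ n) := by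
  induction n with
  | zero => simpa using one
  | succ n ih => rw [pow_succ, pow_succ]; exact ih.mul h

/-- Plus–minus pairs are closed under finite products. [cite: GlimmJaffeQP1987, Lemma 4.1.2 (p. 56)] -/
theorem prod {ι : Type*} (s : Finset ι) {f g : ι → MvPolynomial τ ℝ}
    (hfg : ∀ i ∈ s, IsPMPair (f i) (g i)) : IsPMPair (∏ i ∈ s, f i) (∏ i ∈ s, g i) := by
  classical
  induction s using Finset.induction_on with
  | empty => simpa using one
  | insert i s hi ih =>
    rw [Finset.prod_insert hi, Finset.prod_insert hi]
    exact (hfg i (Finset.mem_insert_self i s)).mul (ih fun j hj => hfg j (Finset.mem_insert_of_mem hj))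

/-- Plus–minus pairs are closed under finite sums. [folklore] -/
theorem sum {ι : Type*} (s : Finset ι) {f g : ι → MvPolynomial τ ℝ}
    (hfg : ∀ i ∈ s, IsPMPair (f i) (g i)) : IsPMPair (∑ i ∈ s, f i) (∑ i ∈ s, g i) := by
  classical
  induction s using Finset.induction_on with
  | empty =>
    simp only [Finset.sum_empty]
    exact ⟨by simpa using IsFerromagnetic.zero, by simpa using IsFerromagnetic.zero⟩
  | insert i s hi ih =>
    rw [Finset.sum_insert hi, Finset.sum_insert hi]
    exact (hfg i (Finset.mem_insert_self i s)).add (ih fun j hj => hfg j (Finset.mem_insert_of_mem hj))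

end IsPMPair

/-- The generators: `((t_s + q_s)/2, (t_s − q_s)/2)` is a plus–minus pair (sum `t_s`, difference
`q_s`). [cite: GlimmJaffeQP1987, Lemma 4.1.2 (p. 56)] -/
theorem isPMPair_plusSub_minusSub_X (s : σ) :
    IsPMPair (plusSub (X s : MvPolynomial σ ℝ)) (minusSub (X s)) := by
  rw [plusSub_X, minusSub_X]
  refine ⟨?_, ?_⟩
  · have key : C (1 / 2 : ℝ) * (X (Sum.inl s) + X (Sum.inr s)) +
        C (1 / 2 : ℝ) * (X (Sum.inl s) - X (Sum.inr s)) =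
        C (1 / 2 : ℝ) * (X (Sum.inl s) + X (Sum.inl s) : MvPolynomial (σ ⊕ σ) ℝ) := by ring
    rw [key, C_mul']
    exact ((IsFerromagnetic.X _).add (IsFerromagnetic.X _)).smul (by norm_num)
  · have key : C (1 / 2 : ℝ) * (X (Sum.inl s) + X (Sum.inr s)) -
        C (1 / 2 : ℝ) * (X (Sum.inl s) - X (Sum.inr s)) =
        C (1 / 2 : ℝ) * (X (Sum.inr s) + X (Sum.inr s) : MvPolynomial (σ ⊕ σ) ℝ) := by ring
    rw [key, C_mul']
    exact ((IsFerromagnetic.X _).add (IsFerromagnetic.X _)).smul (by norm_num)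

/-- **Glimm–Jaffe's Lemma 4.1.2** (for any ferromagnetic polynomial `p`, by linearity from the
monomials `ξ^A`): `p(ξ) + p(χ)` and `p(ξ) − p(χ)`, written as polynomials in the duplicated
variables `t = ξ + χ`, `q = ξ − χ`, are ferromagnetic. [cite: GlimmJaffeQP1987, Lemma 4.1.2 (p. 56)] -/
theorem IsFerromagnetic.isPMPair_plusSub_minusSub {p : MvPolynomial σ ℝ} (hp : IsFerromagnetic p) :
    IsPMPair (plusSub p) (minusSub p) := by
  classical
  conv => enter [1]; rw [p.as_sum]
  conv => enter [2]; rw [p.as_sum]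
  rw [map_sum, map_sum]
  refine IsPMPair.sum _ fun d _ => ?_
  rw [monomial_eq, map_mul, map_mul, algHom_C, algHom_C]
  refine IsPMPair.C_mul ?_ (hp d)
  simp only [Finsupp.prod, map_prod, map_pow]
  exact IsPMPair.prod _ fun s _ => (isPMPair_plusSub_minusSub_X s).pow _

end Doubling

/-! ### Linear involutions preserve Lebesgue measure -/

section Haar

/-- A linear involution of a finite-dimensional real vector space preserves every additive Haar
measure (its determinant is `±1`; Mathlib `Measure.map_linearMap_addHaar_eq_smul_addHaar`).
[folklore] -/
theorem measurePreserving_linear_of_comp_self {E : Type*} [NormedAddCommGroup E]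
    [NormedSpace ℝ E] [MeasurableSpace E] [BorelSpace E] [FiniteDimensional ℝ E] (μ : Measure E)
    [μ.IsAddHaarMeasure] (f : E →ₗ[ℝ] E) (hf : f.comp f = LinearMap.id) :
    MeasurePreserving f μ μ := by
  have hdet : LinearMap.det f * LinearMap.det f = 1 := by
    rw [← LinearMap.det_comp, hf, LinearMap.det_id]
  have hne : LinearMap.det f ≠ 0 := fun h0 => by simp [h0] at hdet
  refine ⟨f.continuous_of_finiteDimensional.measurable, ?_⟩
  rw [Measure.map_linearMap_addHaar_eq_smul_addHaar μ hne]
  have habs : |(LinearMap.det f)⁻¹| = 1 := by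
    rcases mul_self_eq_one_iff.1 hdet with h1 | h1 <;> simp [h1]
  rw [habs, ENNReal.ofReal_one, one_smul]

end Haar

/-! ### Real lattice spins with even single-site potentials: the Griffiths inequalities -/

section Lattice

variable {V : Type*} [Fintype V]

/-- Hypotheses on a family of single-site potentials `U_x` (a priori measures
`dμ_x = e^{-U_x(u)} du` on `ℝ`): measurable, **even** (Glimm–Jaffe 1987, Thm 4.1.1: "`dμ_i(ξ_i)`
symmetric under `ξ_i → −ξ_i`"), and dominating every Gaussian, `∫ e^{a u²} e^{−U_x(u)} du < ∞` for
all real `a` (the form of the integrability hypothesis (4.1.4) adequate for pair interactions;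
e.g. `U_x(u) = g u⁴ + κ u²`, `g > 0`). [cite: GlimmJaffeQP1987, §4.1 Thm 4.1.1 and (4.1.4) (pp. 55–56)] -/
structure IsEvenSitePotential (U : V → ℝ → ℝ) : Prop where
  measurable : ∀ x, Measurable (U x)
  even : ∀ x u, U x (-u) = U x u
  integrable_exp_mul_sq : ∀ x (a : ℝ),
    Integrable (fun u : ℝ => Real.exp (a * u ^ 2) * Real.exp (-U x u))

/-- Quadratic growth of an interaction polynomial on the nonnegative orthant,
`H(x) ≤ C (1 + ∑_s x_s²)` for `x ≥ 0` (satisfied by ferromagnetic pair interactions and external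
fields). [folklore] -/
def HasQuadraticGrowth (H : MvPolynomial V ℝ) : Prop :=
  ∃ C : ℝ, 0 ≤ C ∧ ∀ x : V → ℝ, (∀ s, 0 ≤ x s) → eval x H ≤ C * (1 + ∑ s, x s ^ 2)

omit [Fintype V] in
/-- Quadratic growth is preserved by sums. [folklore] -/
theorem HasQuadraticGrowth.add [Fintype V] {H D : MvPolynomial V ℝ} (hH : HasQuadraticGrowth H)
    (hD : HasQuadraticGrowth D) : HasQuadraticGrowth (H + D) := by
  obtain ⟨C, hC0, hC⟩ := hH
  obtain ⟨C', hC0', hC'⟩ := hD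
  refine ⟨C + C', add_nonneg hC0 hC0', fun x hx => ?_⟩
  rw [map_add]
  have := hC x hx
  have := hC' x hx
  linarith

/-- Quadratic growth is preserved by nonnegative scalars. [folklore] -/
theorem HasQuadraticGrowth.smul {H : MvPolynomial V ℝ} (hH : HasQuadraticGrowth H) {c : ℝ}
    (hc : 0 ≤ c) : HasQuadraticGrowth (c • H) := by
  obtain ⟨C, hC0, hC⟩ := hH
  refine ⟨c * C, mul_nonneg hc hC0, fun x hx => ?_⟩
  rw [smul_eval, mul_assoc]
  exact mul_le_mul_of_nonneg_left (hC x hx) hc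

/-- The Boltzmann weight `e^{H(φ)} e^{−∑_x U_x(φ_x)}` of the lattice spin system with single-site
potentials `U` and interaction polynomial `H` against Lebesgue measure `∏_x dφ_x`
(Glimm–Jaffe 1987, (4.1.5)–(4.1.6): `Z = ∫ e^{−H(ξ)} dμ(ξ)`, with the sign convention `H ↦ −H` so
that ferromagnetic means `H` has nonnegative coefficients). [cite: GlimmJaffeQP1987, §4.1 (4.1.5)–(4.1.6)] -/
def boltzWeight (U : V → ℝ → ℝ) (H : MvPolynomial V ℝ) (φ : V → ℝ) : ℝ :=
  Real.exp (eval φ H) * Real.exp (-∑ x, U x (φ x))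

/-- The Boltzmann weight is nonnegative. [folklore] -/
theorem boltzWeight_nonneg (U : V → ℝ → ℝ) (H : MvPolynomial V ℝ) (φ : V → ℝ) :
    0 ≤ boltzWeight U H φ :=
  mul_nonneg (Real.exp_nonneg _) (Real.exp_nonneg _)

/-- The a priori density `e^{−∑ U_x(φ_x)}` is measurable. [folklore] -/
theorem measurable_expNegSum {U : V → ℝ → ℝ} (hU : ∀ x, Measurable (U x)) :
    Measurable fun φ : V → ℝ => Real.exp (-∑ x, U x (φ x)) :=
  Real.measurable_exp.comp
    (Finset.measurable_sum _ fun x _ => (hU x).comp (measurable_pi_apply x)).neg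

/-- The Boltzmann weight is measurable. [folklore] -/
theorem measurable_boltzWeight {U : V → ℝ → ℝ} (hU : ∀ x, Measurable (U x))
    (H : MvPolynomial V ℝ) : Measurable (boltzWeight U H) :=
  (Real.measurable_exp.comp (MvPolynomial.continuous_eval H).measurable).mul (measurable_expNegSum hU)

/-! #### Gaussian domination of polynomial factors -/

omit [Fintype V] in
/-- `|u|^n ≤ e^{n u²}` (from `|u| ≤ 1 + u² ≤ e^{u²}`). [folklore] -/
theorem abs_pow_le_exp_mul_sq (u : ℝ) (n : ℕ) : |u| ^ n ≤ Real.exp (n * u ^ 2) := by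
  have h1 : |u| ≤ Real.exp (u ^ 2) := by
    have h2 : |u| ≤ u ^ 2 + 1 := by
      rcases le_or_gt |u| 1 with h | h
      · nlinarith [sq_nonneg u]
      · have : |u| ^ 2 = u ^ 2 := sq_abs u
        nlinarith
    exact h2.trans (Real.add_one_le_exp _)
  rw [Real.exp_nat_mul]
  exact pow_le_pow_left₀ (abs_nonneg u) h1 n

/-- A monomial in `|x_s|` is dominated by a Gaussian in the total square:
`∏_s |x_s|^{m_s} ≤ exp ((∑_s m_s) ∑_s x_s²)`. [folklore] -/
theorem prod_abs_pow_le_exp {ι : Type*} [Fintype ι] (x : ι → ℝ) (m : ι →₀ ℕ) :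
    ∏ s, |x s| ^ m s ≤ Real.exp ((∑ s, m s : ℕ) * ∑ s, x s ^ 2) := by
  calc ∏ s, |x s| ^ m s ≤ ∏ s, Real.exp (m s * x s ^ 2) :=
        Finset.prod_le_prod (fun s _ => pow_nonneg (abs_nonneg _) _)
          fun s _ => abs_pow_le_exp_mul_sq (x s) (m s)
    _ = Real.exp (∑ s, (m s : ℝ) * x s ^ 2) := by rw [Real.exp_sum]
    _ ≤ Real.exp ((∑ s, m s : ℕ) * ∑ s, x s ^ 2) := by
        refine Real.exp_le_exp.2 ?_
        rw [Finset.mul_sum]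
        refine Finset.sum_le_sum fun s _ => mul_le_mul_of_nonneg_right ?_ (sq_nonneg _)
        exact_mod_cast Finset.single_le_sum (fun t _ => Nat.zero_le (m t)) (Finset.mem_univ s)

/-- The Gaussian-tilted a priori measure has finite mass:
`∫ e^{a ∑ φ_x²} e^{−∑ U_x(φ_x)} ∏ dφ_x < ∞`. [cite: GlimmJaffeQP1987, §4.1 (4.1.4)] -/
theorem IsEvenSitePotential.integrable_exp_mul_sum_sq {U : V → ℝ → ℝ} (hU : IsEvenSitePotential U)
    (a : ℝ) : Integrable (fun φ : V → ℝ =>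
      Real.exp (a * ∑ x, φ x ^ 2) * Real.exp (-∑ x, U x (φ x))) := by
  have h := Integrable.fintype_prod (ι := V)
    (f := fun (x : V) (u : ℝ) => Real.exp (a * u ^ 2) * Real.exp (-U x u))
    (μ := fun _ => (volume : Measure ℝ)) fun x => hU.integrable_exp_mul_sq x a
  rw [← volume_pi] at h
  refine h.congr (Eventually.of_forall fun φ => ?_)
  simp only
  rw [Finset.prod_mul_distrib, ← Real.exp_sum, ← Real.exp_sum, Finset.mul_sum,
    Finset.sum_neg_distrib]

/-- **The integrability hypothesis (4.1.4) for the single lattice**: for an interaction of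
quadratic growth, `|φ|^m e^{H(|φ|)} e^{−∑ U_x(φ_x)}` is Lebesgue integrable for every exponent `m`.
[cite: GlimmJaffeQP1987, §4.1 (4.1.4)] -/
theorem IsEvenSitePotential.integrable_prod_abs_pow {U : V → ℝ → ℝ} (hU : IsEvenSitePotential U)
    {H : MvPolynomial V ℝ} (hHq : HasQuadraticGrowth H) (m : V →₀ ℕ) :
    Integrable (fun φ : V → ℝ => (∏ s, |φ s| ^ m s) *
      Real.exp (eval (fun s => |φ s|) H) * Real.exp (-∑ x, U x (φ x))) := by
  obtain ⟨C, -, hC⟩ := hHq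
  obtain ⟨N, hN⟩ : ∃ N : ℕ, N = ∑ s, m s := ⟨_, rfl⟩
  have hbound : ∀ φ : V → ℝ, (∏ s, |φ s| ^ m s) * Real.exp (eval (fun s => |φ s|) H) *
      Real.exp (-∑ x, U x (φ x)) ≤ Real.exp C *
        (Real.exp ((N + C) * ∑ x, φ x ^ 2) * Real.exp (-∑ x, U x (φ x))) := by
    intro φ
    have h1 := prod_abs_pow_le_exp φ m
    have h2 : eval (fun s => |φ s|) H ≤ C * (1 + ∑ s, φ s ^ 2) := by
      have := hC (fun s => |φ s|) fun s => abs_nonneg _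
      simpa only [sq_abs] using this
    rw [← hN] at h1
    calc (∏ s, |φ s| ^ m s) * Real.exp (eval (fun s => |φ s|) H) * Real.exp (-∑ x, U x (φ x))
        ≤ Real.exp (N * ∑ s, φ s ^ 2) * Real.exp (C * (1 + ∑ s, φ s ^ 2)) *
            Real.exp (-∑ x, U x (φ x)) := by
          gcongr
      _ = Real.exp C * (Real.exp ((N + C) * ∑ x, φ x ^ 2) * Real.exp (-∑ x, U x (φ x))) := by
          simp only [← Real.exp_add]
          congr 1
          ring
  refine ((hU.integrable_exp_mul_sum_sq (N + C)).const_mul (Real.exp C)).mono' ?_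
    (Eventually.of_forall fun φ => ?_)
  · refine ((Finset.measurable_prod _ fun s _ => ?_).mul ?_).mul
      (measurable_expNegSum hU.measurable) |>.aestronglyMeasurable
    · exact ((measurable_pi_apply s).abs).pow_const _
    · exact Real.measurable_exp.comp ((MvPolynomial.continuous_eval H).measurable.comp
        (measurable_pi_lambda _ fun s => (measurable_pi_apply s).abs))
  · rw [Real.norm_of_nonneg (mul_nonneg (mul_nonneg
      (Finset.prod_nonneg fun s _ => pow_nonneg (abs_nonneg _) _) (Real.exp_nonneg _))
      (Real.exp_nonneg _))]
    exact hbound φ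

/-- Integrable dominator `p(|φ|) e^{H(|φ|)} e^{−∑U}` for a ferromagnetic observable `p`. [cite: GlimmJaffeQP1987, §4.1 (4.1.4)] -/
theorem IsEvenSitePotential.integrable_evalAbs {U : V → ℝ → ℝ} (hU : IsEvenSitePotential U)
    {H : MvPolynomial V ℝ} (hHq : HasQuadraticGrowth H) (p : MvPolynomial V ℝ) :
    Integrable (fun φ : V → ℝ => eval (fun s => |φ s|) p *
      Real.exp (eval (fun s => |φ s|) H) * Real.exp (-∑ x, U x (φ x))) := by
  have heq : (fun φ : V → ℝ => eval (fun s => |φ s|) p *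
      Real.exp (eval (fun s => |φ s|) H) * Real.exp (-∑ x, U x (φ x))) =
      fun φ => ∑ m ∈ p.support, p.coeff m * ((∏ s, |φ s| ^ m s) *
        Real.exp (eval (fun s => |φ s|) H) * Real.exp (-∑ x, U x (φ x))) := by
    funext φ
    rw [eval_eq', Finset.sum_mul, Finset.sum_mul]
    exact Finset.sum_congr rfl fun m _ => by ring
  rw [heq]
  exact integrable_finsetSum _ fun m _ => (hU.integrable_prod_abs_pow hHq m).const_mul _

/-- A ferromagnetic observable times the Boltzmann weight is integrable. [cite: GlimmJaffeQP1987, §4.1 (4.1.4)] -/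
theorem IsEvenSitePotential.integrable_eval_mul_boltzWeight {U : V → ℝ → ℝ}
    (hU : IsEvenSitePotential U) {H : MvPolynomial V ℝ} (hH : IsFerromagnetic H)
    (hHq : HasQuadraticGrowth H) {p : MvPolynomial V ℝ} (hp : IsFerromagnetic p) :
    Integrable (fun φ : V → ℝ => eval φ p * boltzWeight U H φ) := by
  refine (hU.integrable_evalAbs hHq p).mono' ?_ (Eventually.of_forall fun φ => ?_)
  · exact ((MvPolynomial.continuous_eval p).measurable.mul
      (measurable_boltzWeight hU.measurable H)).aestronglyMeasurable
  · rw [Real.norm_eq_abs, abs_mul, abs_of_nonneg (boltzWeight_nonneg U H φ), boltzWeight,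
      ← mul_assoc]
    refine mul_le_mul_of_nonneg_right ?_ (Real.exp_nonneg _)
    exact mul_le_mul (hp.abs_eval_le φ) (Real.exp_le_exp.2 ((le_abs_self _).trans
      (hH.abs_eval_le φ))) (Real.exp_nonneg _) ((abs_nonneg _).trans (hp.abs_eval_le φ))

/-! #### The single lattice as a Ginibre system: first Griffiths inequality -/

variable [DecidableEq V]

/-- Reflection of the `s`-th spin, `φ ↦ (φ with φ_s ↦ −φ_s)`, as a linear map. [folklore] -/
def spinReflect (s : V) : (V → ℝ) →ₗ[ℝ] (V → ℝ) where
  toFun φ := Function.update φ s (-φ s)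
  map_add' φ ψ := by
    ext t
    by_cases h : t = s <;> simp [h]; ring
  map_smul' c φ := by
    ext t
    by_cases h : t = s <;> simp [h]

omit [Fintype V] in
/-- Coordinates of the spin reflection. [folklore] -/
theorem spinReflect_apply (s : V) (φ : V → ℝ) (t : V) :
    spinReflect s φ t = if t = s then -φ s else φ t := by
  simp [spinReflect, Function.update_apply]

omit [Fintype V] in
/-- The spin reflection is an involution. [folklore] -/
theorem spinReflect_comp_self (s : V) : (spinReflect s).comp (spinReflect s) = LinearMap.id := by
  refine LinearMap.ext fun φ => funext fun t => ?_
  simp only [LinearMap.comp_apply, LinearMap.id_apply, spinReflect_apply]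
  by_cases h : t = s <;> simp [h]

/-- **The single lattice is a Ginibre system** (Glimm–Jaffe 1987, Thm 4.1.1: Lebesgue measure and
the even weight `∏ e^{−U_x(φ_x)}` are invariant under each spin reflection `φ_s ↦ −φ_s`).
[cite: GlimmJaffeQP1987, Thm 4.1.1 (p. 56)] -/
theorem isGinibreSystem_single {U : V → ℝ → ℝ} (hU : IsEvenSitePotential U) :
    IsGinibreSystem (volume : Measure (V → ℝ)) (fun φ => φ) (fun s => ⇑(spinReflect s))
      (fun φ => Real.exp (-∑ x, U x (φ x))) where
  measurable := measurable_id
  measurePreserving s :=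
    measurePreserving_linear_of_comp_self volume (spinReflect s) (spinReflect_comp_self s)
  apply_flip s φ := by simp [spinReflect_apply]
  apply_of_ne s t hts φ := by simp [spinReflect_apply, hts]
  measurable_weight := measurable_expNegSum hU.measurable
  weight_nonneg φ := Real.exp_nonneg _
  weight_flip s φ := by
    congr 2
    refine Finset.sum_congr rfl fun x _ => ?_
    by_cases h : x = s
    · subst h; simp [spinReflect_apply, hU.even]
    · simp [spinReflect_apply, h]

/-- **First Griffiths inequality for real lattice spins** (Glimm–Jaffe 1987, Thm 4.1.1, and its
extension from moments `ξ^A` to all ferromagnetic observables): for even single-site potentials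
`U_x` dominating Gaussians and a ferromagnetic interaction `H` of quadratic growth, every
ferromagnetic polynomial `p` has `0 ≤ ∫ p(φ) e^{H(φ)} ∏ₓ e^{−U_x(φ_x)} dφ_x` (un-normalised
expectation). [cite: GlimmJaffeQP1987, Thm 4.1.1 (p. 56)] -/
theorem griffiths_first {U : V → ℝ → ℝ} (hU : IsEvenSitePotential U) {H : MvPolynomial V ℝ}
    (hH : IsFerromagnetic H) (hHq : HasQuadraticGrowth H) {p : MvPolynomial V ℝ}
    (hp : IsFerromagnetic p) :
    0 ≤ ∫ φ, eval φ p * boltzWeight U H φ := by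
  have h := (isGinibreSystem_single hU).integral_eval_mul_exp_mul_weight_nonneg hp hH
    (hU.integrable_prod_abs_pow hHq)
  simpa only [boltzWeight, mul_assoc] using h

/-! #### Ginibre's doubled lattice and the second Griffiths inequality -/

/-- Exchange of the `s`-th spins of the two copies, `(ξ_s, χ_s) ↦ (χ_s, ξ_s)` — in the variables
`t = ξ + χ`, `q = ξ − χ` this is the reflection `q_s ↦ −q_s` (Glimm–Jaffe 1987, (4.1.13)).
[cite: GlimmJaffeQP1987, §4.1 (4.1.13)] -/
def swapAt (s : V) : ((V → ℝ) × (V → ℝ)) →ₗ[ℝ] ((V → ℝ) × (V → ℝ)) where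
  toFun ω := (Function.update ω.1 s (ω.2 s), Function.update ω.2 s (ω.1 s))
  map_add' ω ω' := by
    refine Prod.ext (funext fun t => ?_) (funext fun t => ?_) <;>
      by_cases h : t = s <;> simp [h]
  map_smul' c ω := by
    refine Prod.ext (funext fun t => ?_) (funext fun t => ?_) <;>
      by_cases h : t = s <;> simp [h]

/-- Exchange-and-negate of the `s`-th spins of the two copies, `(ξ_s, χ_s) ↦ (−χ_s, −ξ_s)` — in the
variables `t = ξ + χ`, `q = ξ − χ` this is the reflection `t_s ↦ −t_s` (Glimm–Jaffe 1987,
(4.1.13)). [cite: GlimmJaffeQP1987, §4.1 (4.1.13)] -/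
def swapNegAt (s : V) : ((V → ℝ) × (V → ℝ)) →ₗ[ℝ] ((V → ℝ) × (V → ℝ)) where
  toFun ω := (Function.update ω.1 s (-ω.2 s), Function.update ω.2 s (-ω.1 s))
  map_add' ω ω' := by
    refine Prod.ext (funext fun t => ?_) (funext fun t => ?_) <;>
      by_cases h : t = s <;> simp [h] <;> ring
  map_smul' c ω := by
    refine Prod.ext (funext fun t => ?_) (funext fun t => ?_) <;>
      by_cases h : t = s <;> simp [h]

omit [Fintype V] in
/-- First copy after the exchange at `s`. [folklore] -/
theorem swapAt_fst (s : V) (ω : (V → ℝ) × (V → ℝ)) (t : V) :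
    (swapAt s ω).1 t = if t = s then ω.2 s else ω.1 t := by
  simp [swapAt, Function.update_apply]

omit [Fintype V] in
/-- Second copy after the exchange at `s`. [folklore] -/
theorem swapAt_snd (s : V) (ω : (V → ℝ) × (V → ℝ)) (t : V) :
    (swapAt s ω).2 t = if t = s then ω.1 s else ω.2 t := by
  simp [swapAt, Function.update_apply]

omit [Fintype V] in
/-- First copy after the exchange-and-negate at `s`. [folklore] -/
theorem swapNegAt_fst (s : V) (ω : (V → ℝ) × (V → ℝ)) (t : V) :
    (swapNegAt s ω).1 t = if t = s then -ω.2 s else ω.1 t := by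
  simp [swapNegAt, Function.update_apply]

omit [Fintype V] in
/-- Second copy after the exchange-and-negate at `s`. [folklore] -/
theorem swapNegAt_snd (s : V) (ω : (V → ℝ) × (V → ℝ)) (t : V) :
    (swapNegAt s ω).2 t = if t = s then -ω.1 s else ω.2 t := by
  simp [swapNegAt, Function.update_apply]

omit [Fintype V] in
/-- The exchange at `s` is an involution. [folklore] -/
theorem swapAt_comp_self (s : V) : (swapAt s).comp (swapAt s) = LinearMap.id := by
  refine LinearMap.ext fun ω => Prod.ext (funext fun t => ?_) (funext fun t => ?_)
  · simp only [LinearMap.comp_apply, LinearMap.id_apply, swapAt_fst, swapAt_snd]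
    by_cases h : t = s <;> simp [h]
  · simp only [LinearMap.comp_apply, LinearMap.id_apply, swapAt_fst, swapAt_snd]
    by_cases h : t = s <;> simp [h]

omit [Fintype V] in
/-- The exchange-and-negate at `s` is an involution. [folklore] -/
theorem swapNegAt_comp_self (s : V) : (swapNegAt s).comp (swapNegAt s) = LinearMap.id := by
  refine LinearMap.ext fun ω => Prod.ext (funext fun t => ?_) (funext fun t => ?_)
  · simp only [LinearMap.comp_apply, LinearMap.id_apply, swapNegAt_fst, swapNegAt_snd]
    by_cases h : t = s <;> simp [h]
  · simp only [LinearMap.comp_apply, LinearMap.id_apply, swapNegAt_fst, swapNegAt_snd]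
    by_cases h : t = s <;> simp [h]

/-- Ginibre's duplicated coordinates `t_s = ξ_s + χ_s` (`inl s`) and `q_s = ξ_s − χ_s` (`inr s`)
on the doubled configuration space (Glimm–Jaffe 1987, (4.1.7), un-normalised).
[cite: GlimmJaffeQP1987, §4.1 (4.1.7)] -/
def doubleCoord (ω : (V → ℝ) × (V → ℝ)) : V ⊕ V → ℝ :=
  Sum.elim (ω.1 + ω.2) (ω.1 - ω.2)

omit [Fintype V] [DecidableEq V] in
/-- `t_s = ξ_s + χ_s`. [cite: GlimmJaffeQP1987, §4.1 (4.1.7) (p. 56)] -/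
@[simp] theorem doubleCoord_inl (ω : (V → ℝ) × (V → ℝ)) (s : V) :
    doubleCoord ω (Sum.inl s) = ω.1 s + ω.2 s := rfl

omit [Fintype V] [DecidableEq V] in
/-- `q_s = ξ_s − χ_s`. [cite: GlimmJaffeQP1987, §4.1 (4.1.7) (p. 56)] -/
@[simp] theorem doubleCoord_inr (ω : (V → ℝ) × (V → ℝ)) (s : V) :
    doubleCoord ω (Sum.inr s) = ω.1 s - ω.2 s := rfl

omit [Fintype V] [DecidableEq V] in
/-- The duplicated coordinates are measurable. [folklore] -/
theorem measurable_doubleCoord : Measurable (doubleCoord (V := V)) := by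
  refine measurable_pi_lambda _ fun k => ?_
  rcases k with s | s
  · simp only [doubleCoord_inl]
    exact ((measurable_pi_apply s).comp measurable_fst).add
      ((measurable_pi_apply s).comp measurable_snd)
  · simp only [doubleCoord_inr]
    exact ((measurable_pi_apply s).comp measurable_fst).sub
      ((measurable_pi_apply s).comp measurable_snd)

/-- The reflections of the doubled lattice: `t_s ↦ −t_s` is `swapNegAt s`, `q_s ↦ −q_s` is
`swapAt s`. [cite: GlimmJaffeQP1987, §4.1 (4.1.13)] -/
def doubleReflect : V ⊕ V → ((V → ℝ) × (V → ℝ)) → ((V → ℝ) × (V → ℝ)) :=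
  Sum.elim (fun s => ⇑(swapNegAt s)) (fun s => ⇑(swapAt s))

/-- The weight of the doubled lattice, `e^{−∑_x (U_x(ξ_x) + U_x(χ_x))}`. [cite: GlimmJaffeQP1987, §4.1 (4.1.8)] -/
def doubleWeight (U : V → ℝ → ℝ) (ω : (V → ℝ) × (V → ℝ)) : ℝ :=
  Real.exp (-∑ x, (U x (ω.1 x) + U x (ω.2 x)))

omit [DecidableEq V] in
/-- The doubled weight factorises over the two copies. [folklore] -/
theorem doubleWeight_eq (U : V → ℝ → ℝ) (ω : (V → ℝ) × (V → ℝ)) :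
    doubleWeight U ω = Real.exp (-∑ x, U x (ω.1 x)) * Real.exp (-∑ x, U x (ω.2 x)) := by
  rw [doubleWeight, ← Real.exp_add, Finset.sum_add_distrib, neg_add]

/-- **Ginibre's doubled lattice is a Ginibre system** (Glimm–Jaffe 1987, (4.1.13): the product
measure `dμ(ξ) dμ(χ)` is symmetric under `(q, t) → (−q, t)` and `(q, t) → (q, −t)` sitewise; here
realised by the exchange / exchange-and-negate of `ξ_s`, `χ_s`, which preserve Lebesgue measure
and, by evenness, the weight). [cite: GlimmJaffeQP1987, Thm 4.1.3 with (4.1.13) (pp. 56–57)] -/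
theorem isGinibreSystem_double {U : V → ℝ → ℝ} (hU : IsEvenSitePotential U) :
    IsGinibreSystem ((volume : Measure (V → ℝ)).prod volume) doubleCoord doubleReflect
      (doubleWeight U) where
  measurable := measurable_doubleCoord
  measurePreserving k := by
    haveI : ((volume : Measure (V → ℝ)).prod (volume : Measure (V → ℝ))).IsAddHaarMeasure :=
      Measure.prod.instIsAddHaarMeasure _ _
    rcases k with s | s
    · exact measurePreserving_linear_of_comp_self _ (swapNegAt s) (swapNegAt_comp_self s)
    · exact measurePreserving_linear_of_comp_self _ (swapAt s) (swapAt_comp_self s)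
  apply_flip k ω := by
    rcases k with s | s
    · simp only [doubleReflect, Sum.elim_inl, doubleCoord_inl, swapNegAt_fst, swapNegAt_snd,
        if_true]
      ring
    · simp only [doubleReflect, Sum.elim_inr, doubleCoord_inr, swapAt_fst, swapAt_snd, if_true]
      ring
  apply_of_ne k k' hk ω := by
    rcases k with s | s <;> rcases k' with t | t
    · have hts : t ≠ s := fun h => hk (by rw [h])
      simp [doubleReflect, swapNegAt_fst, swapNegAt_snd, hts]
    · by_cases hts : t = s
      · subst hts; simp [doubleReflect, swapNegAt_fst, swapNegAt_snd]; ring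
      · simp [doubleReflect, swapNegAt_fst, swapNegAt_snd, hts]
    · by_cases hts : t = s
      · subst hts; simp [doubleReflect, swapAt_fst, swapAt_snd]; ring
      · simp [doubleReflect, swapAt_fst, swapAt_snd, hts]
    · have hts : t ≠ s := fun h => hk (by rw [h])
      simp [doubleReflect, swapAt_fst, swapAt_snd, hts]
  measurable_weight :=
    Real.measurable_exp.comp (Finset.measurable_sum _ fun x _ =>
      ((hU.measurable x).comp ((measurable_pi_apply x).comp measurable_fst)).add
      ((hU.measurable x).comp ((measurable_pi_apply x).comp measurable_snd))).neg
  weight_nonneg ω := Real.exp_nonneg _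
  weight_flip k ω := by
    unfold doubleWeight
    congr 2
    refine Finset.sum_congr rfl fun x _ => ?_
    rcases k with s | s
    · by_cases h : x = s
      · subst h; simp [doubleReflect, swapNegAt_fst, swapNegAt_snd, hU.even, add_comm]
      · simp [doubleReflect, swapNegAt_fst, swapNegAt_snd, h]
    · by_cases h : x = s
      · subst h; simp [doubleReflect, swapAt_fst, swapAt_snd, add_comm]
      · simp [doubleReflect, swapAt_fst, swapAt_snd, h]

omit [Fintype V] [DecidableEq V] in
/-- Evaluation of the substitutions on an arbitrary point of the doubled variables:
`plusSub p (z) = p ((z_{inl ·} + z_{inr ·})/2)`. [cite: GlimmJaffeQP1987, §4.1 (4.1.7)] -/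
theorem eval_plusSub_apply (z : V ⊕ V → ℝ) (p : MvPolynomial V ℝ) :
    eval z (plusSub p) = eval (fun s => 1 / 2 * (z (Sum.inl s) + z (Sum.inr s))) p := by
  change eval₂Hom (RingHom.id ℝ) _ (bind₁ _ p) = _
  rw [eval₂Hom_bind₁]
  change eval (fun s => eval z (C (1 / 2 : ℝ) * (X (Sum.inl s) + X (Sum.inr s)))) p = _
  congr 2
  funext s
  simp

omit [Fintype V] [DecidableEq V] in
/-- `minusSub p (z) = p ((z_{inl ·} − z_{inr ·})/2)`. [cite: GlimmJaffeQP1987, §4.1 (4.1.7)] -/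
theorem eval_minusSub_apply (z : V ⊕ V → ℝ) (p : MvPolynomial V ℝ) :
    eval z (minusSub p) = eval (fun s => 1 / 2 * (z (Sum.inl s) - z (Sum.inr s))) p := by
  change eval₂Hom (RingHom.id ℝ) _ (bind₁ _ p) = _
  rw [eval₂Hom_bind₁]
  change eval (fun s => eval z (C (1 / 2 : ℝ) * (X (Sum.inl s) - X (Sum.inr s)))) p = _
  congr 2
  funext s
  simp

omit [DecidableEq V] in
/-- The squares of the doubled coordinates: `∑_k z_k² = 2 ∑_s (ξ_s² + χ_s²)`. [folklore] -/
theorem sum_doubleCoord_sq (ω : (V → ℝ) × (V → ℝ)) :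
    ∑ k, doubleCoord ω k ^ 2 = 2 * (∑ s, ω.1 s ^ 2 + ∑ s, ω.2 s ^ 2) := by
  rw [Fintype.sum_sum_type]
  simp only [doubleCoord_inl, doubleCoord_inr]
  rw [← Finset.sum_add_distrib, ← Finset.sum_add_distrib, Finset.mul_sum]
  exact Finset.sum_congr rfl fun s _ => by ring

omit [DecidableEq V] in
/-- Quadratic growth of the doubled interaction `H(ξ) + H(χ)` in the doubled coordinates:
`(plusSub H + minusSub H)(|z|) ≤ 2C (1 + ∑_s (ξ_s² + χ_s²))`. [folklore] -/
theorem eval_abs_doubleCoord_le {H : MvPolynomial V ℝ} (hH : IsFerromagnetic H) {C : ℝ}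
    (hC0 : 0 ≤ C) (hC : ∀ x : V → ℝ, (∀ s, 0 ≤ x s) → eval x H ≤ C * (1 + ∑ s, x s ^ 2))
    (ω : (V → ℝ) × (V → ℝ)) :
    eval (fun k => |doubleCoord ω k|) (plusSub H + minusSub H) ≤
      2 * C * (1 + (∑ s, ω.1 s ^ 2 + ∑ s, ω.2 s ^ 2)) := by
  set u : V → ℝ := fun s => 1 / 2 * (|ω.1 s + ω.2 s| + |ω.1 s - ω.2 s|) with hu
  have hu0 : ∀ s, 0 ≤ u s := fun s => by positivity
  have husq : ∀ s, u s ^ 2 ≤ ω.1 s ^ 2 + ω.2 s ^ 2 := fun s => by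
    simp only [hu]
    have ha := sq_abs (ω.1 s + ω.2 s)
    have hb := sq_abs (ω.1 s - ω.2 s)
    nlinarith [sq_nonneg (|ω.1 s + ω.2 s| - |ω.1 s - ω.2 s|), abs_nonneg (ω.1 s + ω.2 s),
      abs_nonneg (ω.1 s - ω.2 s)]
  have hplus : eval (fun k => |doubleCoord ω k|) (plusSub H) = eval u H := by
    rw [eval_plusSub_apply]; rfl
  have hminus : eval (fun k => |doubleCoord ω k|) (minusSub H) ≤ eval u H := by
    rw [eval_minusSub_apply]
    refine (le_abs_self _).trans ((hH.abs_eval_le _).trans (hH.eval_mono (fun s => abs_nonneg _)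
      fun s => ?_))
    simp only [doubleCoord_inl, doubleCoord_inr, hu, abs_mul]
    rw [abs_of_pos (by norm_num : (0 : ℝ) < 1 / 2)]
    refine mul_le_mul_of_nonneg_left ?_ (by norm_num)
    exact (abs_sub _ _).trans (by rw [abs_abs, abs_abs])
  have hbound : eval u H ≤ C * (1 + (∑ s, ω.1 s ^ 2 + ∑ s, ω.2 s ^ 2)) := by
    refine (hC u hu0).trans (mul_le_mul_of_nonneg_left ?_ hC0)
    rw [← Finset.sum_add_distrib]
    gcongr with s
    exact husq s
  rw [map_add, hplus]
  linarith

/-- **The integrability hypothesis (4.1.4) for the doubled lattice.** [cite: GlimmJaffeQP1987, §4.1 (4.1.4)] -/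
theorem IsEvenSitePotential.integrable_double {U : V → ℝ → ℝ} (hU : IsEvenSitePotential U)
    {H : MvPolynomial V ℝ} (hH : IsFerromagnetic H) (hHq : HasQuadraticGrowth H)
    (m : V ⊕ V →₀ ℕ) :
    Integrable (fun ω : (V → ℝ) × (V → ℝ) => (∏ k, |doubleCoord ω k| ^ m k) *
      Real.exp (eval (fun k => |doubleCoord ω k|) (plusSub H + minusSub H)) * doubleWeight U ω)
      ((volume : Measure (V → ℝ)).prod volume) := by
  obtain ⟨C, hC0, hC⟩ := hHq
  obtain ⟨N, hN⟩ : ∃ N : ℕ, N = ∑ k, m k := ⟨_, rfl⟩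
  set a : ℝ := 2 * N + 2 * C with ha
  have hbound : ∀ ω : (V → ℝ) × (V → ℝ), (∏ k, |doubleCoord ω k| ^ m k) *
      Real.exp (eval (fun k => |doubleCoord ω k|) (plusSub H + minusSub H)) * doubleWeight U ω ≤
      Real.exp (2 * C) * ((Real.exp (a * ∑ x, ω.1 x ^ 2) * Real.exp (-∑ x, U x (ω.1 x))) *
        (Real.exp (a * ∑ x, ω.2 x ^ 2) * Real.exp (-∑ x, U x (ω.2 x)))) := by
    intro ω
    have h1 := prod_abs_pow_le_exp (doubleCoord ω) m
    rw [← hN, sum_doubleCoord_sq] at h1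
    have h2 := eval_abs_doubleCoord_le hH hC0 hC ω
    rw [doubleWeight_eq]
    calc (∏ k, |doubleCoord ω k| ^ m k) *
          Real.exp (eval (fun k => |doubleCoord ω k|) (plusSub H + minusSub H)) *
          (Real.exp (-∑ x, U x (ω.1 x)) * Real.exp (-∑ x, U x (ω.2 x)))
        ≤ Real.exp (N * (2 * (∑ s, ω.1 s ^ 2 + ∑ s, ω.2 s ^ 2))) *
          Real.exp (2 * C * (1 + (∑ s, ω.1 s ^ 2 + ∑ s, ω.2 s ^ 2))) *
          (Real.exp (-∑ x, U x (ω.1 x)) * Real.exp (-∑ x, U x (ω.2 x))) := by gcongr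
      _ = Real.exp (2 * C) * ((Real.exp (a * ∑ x, ω.1 x ^ 2) * Real.exp (-∑ x, U x (ω.1 x))) *
        (Real.exp (a * ∑ x, ω.2 x ^ 2) * Real.exp (-∑ x, U x (ω.2 x)))) := by
          simp only [← Real.exp_add]
          congr 1
          rw [ha]
          ring
  have hint : Integrable (fun ω : (V → ℝ) × (V → ℝ) => Real.exp (2 * C) *
      ((Real.exp (a * ∑ x, ω.1 x ^ 2) * Real.exp (-∑ x, U x (ω.1 x))) *
        (Real.exp (a * ∑ x, ω.2 x ^ 2) * Real.exp (-∑ x, U x (ω.2 x)))))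
      ((volume : Measure (V → ℝ)).prod volume) :=
    ((hU.integrable_exp_mul_sum_sq a).mul_prod (hU.integrable_exp_mul_sum_sq a)).const_mul _
  refine hint.mono' ?_ (Eventually.of_forall fun ω => ?_)
  · have hsys := isGinibreSystem_double hU
    have habs : ∀ k, Measurable fun ω : (V → ℝ) × (V → ℝ) => |doubleCoord ω k| := fun k =>
      ((measurable_pi_apply k).comp hsys.measurable).abs
    exact (((Finset.measurable_prod _ fun k _ => (habs k).pow_const _).mul
      (Real.measurable_exp.comp ((MvPolynomial.continuous_eval _).measurable.comp
        (measurable_pi_lambda _ habs)))).mul hsys.measurable_weight).aestronglyMeasurable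
  · have h0 : 0 ≤ (∏ k, |doubleCoord ω k| ^ m k) *
        Real.exp (eval (fun k => |doubleCoord ω k|) (plusSub H + minusSub H)) *
        doubleWeight U ω :=
      mul_nonneg (mul_nonneg (Finset.prod_nonneg fun k _ => pow_nonneg (abs_nonneg _) _)
        (Real.exp_nonneg _)) (Real.exp_nonneg _)
    rw [Real.norm_of_nonneg h0]
    exact hbound ω

/-- **Second Griffiths inequality for real lattice spins** (Glimm–Jaffe 1987, Thm 4.1.3,
(4.1.11), extended from moments to ferromagnetic observables; Ginibre 1970): for even
single-site potentials dominating Gaussians and a ferromagnetic interaction `H` of quadratic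
growth, any two ferromagnetic polynomials `p`, `q` are positively correlated,
`⟨p⟩⟨q⟩ ≤ ⟨pq⟩`, written without normalisation as
`(∫ p B)(∫ q B) ≤ (∫ pq B)(∫ B)` with `B = e^{H} ∏ e^{−U_x}`. Proof as printed: in the doubled
system `2[(∫ pq B)(∫ B) − (∫ p B)(∫ q B)] = ∫∫ (p(ξ) − p(χ))(q(ξ) − q(χ)) B(ξ)B(χ)`, and the
integrand is a ferromagnetic polynomial in `t = ξ + χ`, `q = ξ − χ` (Lemma 4.1.2) times the
symmetric weight, so the first Griffiths inequality of the doubled Ginibre system applies.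
[cite: GlimmJaffeQP1987, Thm 4.1.3 (4.1.11) (pp. 56–57)] -/
theorem griffiths_second {U : V → ℝ → ℝ} (hU : IsEvenSitePotential U) {H : MvPolynomial V ℝ}
    (hH : IsFerromagnetic H) (hHq : HasQuadraticGrowth H) {p q : MvPolynomial V ℝ}
    (hp : IsFerromagnetic p) (hq : IsFerromagnetic q) :
    (∫ φ, eval φ p * boltzWeight U H φ) * (∫ φ, eval φ q * boltzWeight U H φ) ≤
      (∫ φ, eval φ (p * q) * boltzWeight U H φ) * (∫ φ, boltzWeight U H φ) := by
  set B := boltzWeight U H with hB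
  -- the doubled Ginibre system and its ferromagnetic data
  have hsys := isGinibreSystem_double hU
  have hp₂ : IsFerromagnetic ((plusSub p - minusSub p) * (plusSub q - minusSub q)) :=
    hp.isPMPair_plusSub_minusSub.2.mul hq.isPMPair_plusSub_minusSub.2
  have hH₂ : IsFerromagnetic (plusSub H + minusSub H) := hH.isPMPair_plusSub_minusSub.1
  have hcore := hsys.integral_eval_mul_exp_mul_weight_nonneg hp₂ hH₂ (hU.integrable_double hH hHq)
  -- identification of the doubled integrand
  have hid : ∀ ω : (V → ℝ) × (V → ℝ),
      eval (doubleCoord ω) ((plusSub p - minusSub p) * (plusSub q - minusSub q)) *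
        Real.exp (eval (doubleCoord ω) (plusSub H + minusSub H)) * doubleWeight U ω =
      (eval ω.1 (p * q) * B ω.1) * B ω.2 - (eval ω.1 p * B ω.1) * (eval ω.2 q * B ω.2) -
        (eval ω.1 q * B ω.1) * (eval ω.2 p * B ω.2) + B ω.1 * (eval ω.2 (p * q) * B ω.2) := by
    intro ω
    simp only [doubleCoord, map_mul, map_sub, map_add, eval_plusSub, eval_minusSub,
      doubleWeight_eq, hB, boltzWeight, Real.exp_add]
    ring
  simp_rw [hid] at hcore
  -- integrability of the four product terms
  have hi1 := hU.integrable_eval_mul_boltzWeight hH hHq (hp.mul hq)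
  have hip := hU.integrable_eval_mul_boltzWeight hH hHq hp
  have hiq := hU.integrable_eval_mul_boltzWeight hH hHq hq
  have hi0 : Integrable B := by
    simpa [hB] using hU.integrable_eval_mul_boltzWeight hH hHq IsFerromagnetic.one
  have hT1 : Integrable (fun ω : (V → ℝ) × (V → ℝ) => (eval ω.1 (p * q) * B ω.1) * B ω.2)
      ((volume : Measure (V → ℝ)).prod volume) := hi1.mul_prod hi0
  have hT2 : Integrable (fun ω : (V → ℝ) × (V → ℝ) => (eval ω.1 p * B ω.1) * (eval ω.2 q * B ω.2))
      ((volume : Measure (V → ℝ)).prod volume) := hip.mul_prod hiq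
  have hT3 : Integrable (fun ω : (V → ℝ) × (V → ℝ) => (eval ω.1 q * B ω.1) * (eval ω.2 p * B ω.2))
      ((volume : Measure (V → ℝ)).prod volume) := hiq.mul_prod hip
  have hT4 : Integrable (fun ω : (V → ℝ) × (V → ℝ) => B ω.1 * (eval ω.2 (p * q) * B ω.2))
      ((volume : Measure (V → ℝ)).prod volume) := hi0.mul_prod hi1
  have hsplit : ∫ ω, ((eval ω.1 (p * q) * B ω.1) * B ω.2 - (eval ω.1 p * B ω.1) *
      (eval ω.2 q * B ω.2) - (eval ω.1 q * B ω.1) * (eval ω.2 p * B ω.2) +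
      B ω.1 * (eval ω.2 (p * q) * B ω.2)) ∂((volume : Measure (V → ℝ)).prod volume) =
      (∫ φ, eval φ (p * q) * B φ) * (∫ φ, B φ) - (∫ φ, eval φ p * B φ) * (∫ φ, eval φ q * B φ) -
        (∫ φ, eval φ q * B φ) * (∫ φ, eval φ p * B φ) +
        (∫ φ, B φ) * (∫ φ, eval φ (p * q) * B φ) := by
    rw [integral_add _ hT4, integral_sub _ hT3, integral_sub hT1 hT2,
      integral_prod_mul (μ := (volume : Measure (V → ℝ))) (ν := volume)
        (fun φ => eval φ (p * q) * B φ) B,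
      integral_prod_mul (μ := (volume : Measure (V → ℝ))) (ν := volume)
        (fun φ => eval φ p * B φ) (fun φ => eval φ q * B φ),
      integral_prod_mul (μ := (volume : Measure (V → ℝ))) (ν := volume)
        (fun φ => eval φ q * B φ) (fun φ => eval φ p * B φ),
      integral_prod_mul (μ := (volume : Measure (V → ℝ))) (ν := volume)
        B (fun φ => eval φ (p * q) * B φ)]
    · exact hT1.sub hT2
    · exact (hT1.sub hT2).sub hT3
  rw [hsplit] at hcore
  nlinarith [hcore]

/-- **Monotonicity in the couplings** (Glimm–Jaffe 1987, Prop. 4.2.1: "`⟨ξ^B⟩`, considered as a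
function of the couplings `J_A` in `H`, is monotone increasing"), derivative-free form: if `D` is
a further ferromagnetic interaction then `⟨p⟩_H ≤ ⟨p⟩_{H+D}` for every ferromagnetic `p`, i.e.
`(∫ p B_H)(∫ B_{H+D}) ≤ (∫ p B_{H+D})(∫ B_H)`. Proof: the second Griffiths inequality for `p`
and the truncated exponentials `∑_{n<N} Dⁿ/n!` (ferromagnetic), and dominated convergence.
[cite: GlimmJaffeQP1987, Prop. 4.2.1 (p. 57)] -/
theorem griffiths_mono {U : V → ℝ → ℝ} (hU : IsEvenSitePotential U) {H D : MvPolynomial V ℝ}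
    (hH : IsFerromagnetic H) (hHq : HasQuadraticGrowth H) (hD : IsFerromagnetic D)
    (hDq : HasQuadraticGrowth D) {p : MvPolynomial V ℝ} (hp : IsFerromagnetic p) :
    (∫ φ, eval φ p * boltzWeight U H φ) * (∫ φ, boltzWeight U (H + D) φ) ≤
      (∫ φ, eval φ p * boltzWeight U (H + D) φ) * (∫ φ, boltzWeight U H φ) := by
  -- GKS II for `p` and the truncated exponentials of `D`
  have hN : ∀ N, (∫ φ, eval φ p * boltzWeight U H φ) *
      (∫ φ, eval φ (1 * expPartial N D) * boltzWeight U H φ) ≤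
      (∫ φ, eval φ (p * expPartial N D) * boltzWeight U H φ) * (∫ φ, boltzWeight U H φ) := by
    intro N
    simpa only [one_mul] using griffiths_second hU hH hHq hp (hD.expPartial N)
  -- dominated convergence on both sides
  have hw : ∀ φ : V → ℝ, 0 ≤ boltzWeight U H φ := boltzWeight_nonneg U H
  have hwm : Measurable (boltzWeight U H) := measurable_boltzWeight hU.measurable H
  have hdom : ∀ {r : MvPolynomial V ℝ}, IsFerromagnetic r → Integrable (fun φ : V → ℝ =>
      eval (fun s => |φ s|) r * Real.exp (eval (fun s => |φ s|) D) * boltzWeight U H φ) := by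
    intro r hr
    refine (hU.integrable_evalAbs (hDq.add hHq) r).mono' ?_ (Eventually.of_forall fun φ => ?_)
    · refine (((MvPolynomial.continuous_eval r).measurable.comp
        (measurable_pi_lambda _ fun s => (measurable_pi_apply s).abs)).mul
        (Real.measurable_exp.comp ((MvPolynomial.continuous_eval D).measurable.comp
        (measurable_pi_lambda _ fun s => (measurable_pi_apply s).abs)))).mul hwm
        |>.aestronglyMeasurable
    · have h0 : 0 ≤ eval (fun s => |φ s|) r := hr.eval_nonneg fun s => abs_nonneg _
      rw [Real.norm_of_nonneg (mul_nonneg (mul_nonneg h0 (Real.exp_nonneg _)) (hw φ)),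
        boltzWeight, ← mul_assoc, map_add, Real.exp_add, mul_assoc (eval _ r), ← mul_assoc]
      refine mul_le_mul_of_nonneg_right ?_ (Real.exp_nonneg _)
      rw [mul_assoc]
      refine mul_le_mul_of_nonneg_left (mul_le_mul_of_nonneg_left (Real.exp_le_exp.2
        ((le_abs_self _).trans (hH.abs_eval_le φ))) (Real.exp_nonneg _)) h0
  have hlim : ∀ {r : MvPolynomial V ℝ}, IsFerromagnetic r →
      Tendsto (fun N => ∫ φ, eval φ (r * expPartial N D) * boltzWeight U H φ) atTop
        (𝓝 (∫ φ, eval φ r * boltzWeight U (H + D) φ)) := by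
    intro r hr
    have h := IsGinibreSystem.tendsto_integral_eval_mul_expPartial (P := volume)
      (Y := fun φ : V → ℝ => φ) measurable_id hwm hw hr hD (hdom hr)
    have heq : (fun φ : V → ℝ => eval φ r * Real.exp (eval φ D) * boltzWeight U H φ) =
        fun φ => eval φ r * boltzWeight U (H + D) φ := by
      funext φ
      simp only [boltzWeight, map_add, Real.exp_add]
      ring
    simpa only [heq] using h
  have hlhs := (hlim IsFerromagnetic.one).const_mul (∫ φ, eval φ p * boltzWeight U H φ)
  have hrhs := (hlim hp).mul_const (∫ φ, boltzWeight U H φ)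
  have h := le_of_tendsto_of_tendsto' hlhs hrhs hN
  simpa only [map_one, one_mul] using h

end Lattice

/-! ### The lattice `φ⁴` measure: Griffiths inequalities and monotonicity in the coupling -/

section Phi4

variable {V : Type*} [Fintype V] [DecidableEq V] (G : SimpleGraph V) [DecidableRel G.Adj]

/-- The single-site `φ⁴` potential `U_x(u) = g u⁴ + κ u²` of `phi4Action`. [cite: GlimmJaffeQP1987, §9.5] -/
def phi4Potential (g κ : ℝ) : V → ℝ → ℝ := fun _ u => g * u ^ 4 + κ * u ^ 2

omit [Fintype V] [DecidableEq V] in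
/-- For `g > 0` the `φ⁴` potential is an even single-site potential dominating every Gaussian:
`e^{a u²} e^{−g u⁴ − κ u²} ≤ e^{C} e^{−u²}` ("the quartic term dominates"). [cite: GlimmJaffeQP1987, §9.6 (9.6.8)] -/
theorem isEvenSitePotential_phi4 {g : ℝ} (hg : 0 < g) (κ : ℝ) :
    IsEvenSitePotential (phi4Potential (V := V) g κ) where
  measurable _ := by unfold phi4Potential; fun_prop
  even _ u := by simp only [phi4Potential]; ring
  integrable_exp_mul_sq _ a := by
    show Integrable (fun u : ℝ => Real.exp (a * u ^ 2) * Real.exp (-(g * u ^ 4 + κ * u ^ 2)))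
    have hb : ∀ u : ℝ, Real.exp (a * u ^ 2) * Real.exp (-(g * u ^ 4 + κ * u ^ 2)) ≤
        Real.exp ((a - κ + 1) ^ 2 / (4 * g)) * Real.exp (-1 * u ^ 2) := by
      intro u
      rw [← Real.exp_add, ← Real.exp_add]
      refine Real.exp_le_exp.2 ?_
      have h := neg_mul_sq_add_mul_le hg (a - κ + 1) (u ^ 2)
      have h4 : u ^ 4 = (u ^ 2) ^ 2 := by ring
      rw [h4]
      linarith
    refine ((integrable_exp_neg_mul_sq one_pos).const_mul
      (Real.exp ((a - κ + 1) ^ 2 / (4 * g)))).mono' ?_ (Eventually.of_forall fun u => ?_)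
    · exact (by fun_prop : Measurable fun u : ℝ =>
        Real.exp (a * u ^ 2) * Real.exp (-(g * u ^ 4 + κ * u ^ 2))).aestronglyMeasurable
    · rw [Real.norm_of_nonneg (mul_nonneg (Real.exp_nonneg _) (Real.exp_nonneg _))]
      exact hb u

omit [DecidableEq V] in
/-- The nearest-neighbour pair interaction `∑_{{x,y} ∈ E(G)} X_x X_y` as a polynomial in the
spins (`eval φ (pairPoly G) = pairInteraction G φ`). [cite: GlimmJaffeQP1987, §9.5] -/
def pairPoly : MvPolynomial V ℝ :=
  ∑ e ∈ G.edgeFinset, Sym2.lift ⟨fun x y => (X x * X y : MvPolynomial V ℝ), fun _ _ => mul_comm _ _⟩ e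

omit [DecidableEq V] in
/-- `pairPoly` evaluates to `pairInteraction`. [folklore] -/
theorem eval_pairPoly (φ : V → ℝ) : eval φ (pairPoly G) = pairInteraction G φ := by
  unfold pairPoly pairInteraction
  rw [map_sum]
  refine Finset.sum_congr rfl fun e _ => ?_
  induction e using Sym2.ind with
  | h x y => simp [Sym2.lift_mk]

omit [DecidableEq V] in
/-- The pair interaction is a ferromagnetic polynomial. [cite: GlimmJaffeQP1987, Prop. 4.2.2 (p. 57)] -/
theorem isFerromagnetic_pairPoly : IsFerromagnetic (pairPoly G) :=
  IsFerromagnetic.sum _ fun e _ => by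
    induction e using Sym2.ind with
    | h x y => simpa [Sym2.lift_mk] using (IsFerromagnetic.X x).mul (IsFerromagnetic.X (σ := V) y)

omit [DecidableEq V] in
/-- The pair interaction has quadratic growth, `|∑_{xy} φ_x φ_y| ≤ #E(G) ∑ φ_z²`. [folklore] -/
theorem hasQuadraticGrowth_pairPoly : HasQuadraticGrowth (pairPoly G) :=
  ⟨G.edgeFinset.card, Nat.cast_nonneg _, fun x _ => by
    rw [eval_pairPoly]
    calc pairInteraction G x ≤ |pairInteraction G x| := le_abs_self _
      _ ≤ G.edgeFinset.card * ∑ z, x z ^ 2 := abs_pairInteraction_le G x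
      _ ≤ G.edgeFinset.card * (1 + ∑ z, x z ^ 2) :=
          mul_le_mul_of_nonneg_left (le_add_of_nonneg_left zero_le_one) (Nat.cast_nonneg _)⟩

omit [DecidableEq V] in
/-- The Boltzmann weight of the `φ⁴` data is `e^{−S}`, `S = phi4Action G g κ J`. [cite: GlimmJaffeQP1987, §9.5–9.6] -/
theorem boltzWeight_phi4 (g κ J : ℝ) (φ : V → ℝ) :
    boltzWeight (phi4Potential g κ) (J • pairPoly G) φ = Real.exp (-phi4Action G g κ J φ) := by
  rw [boltzWeight, smul_eval, eval_pairPoly, ← Real.exp_add]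
  congr 1
  simp only [phi4Action, phi4Potential]
  ring

omit [DecidableEq V] in
/-- Expectations under the `φ⁴` Gibbs measure (an exponential tilt of Lebesgue measure) are
ratios `∫ f e^{−S} / ∫ e^{−S}` (Glimm–Jaffe 1987, (4.1.6)). [cite: GlimmJaffeQP1987, §4.1 (4.1.6)] -/
theorem integral_phi4Measure (g κ J : ℝ) (f : (V → ℝ) → ℝ) :
    ∫ φ, f φ ∂(phi4Measure G g κ J) =
      (∫ φ, f φ * Real.exp (-phi4Action G g κ J φ)) / ∫ φ, Real.exp (-phi4Action G g κ J φ) := by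
  rw [phi4Measure, integral_tilted]
  simp_rw [smul_eq_mul]
  rw [← integral_div]
  refine integral_congr_ae (Eventually.of_forall fun φ => ?_)
  simp only
  ring

omit [DecidableEq V] in
/-- The `φ⁴` partition function is positive for `g > 0`. [cite: GlimmJaffeQP1987, §9.6 (9.6.8)] -/
theorem phi4_partitionFunction_pos {g : ℝ} (hg : 0 < g) (κ J : ℝ) :
    0 < ∫ φ : V → ℝ, Real.exp (-phi4Action G g κ J φ) :=
  integral_exp_pos (integrable_exp_neg_phi4Action G hg κ J)

/-- **First Griffiths inequality for the lattice `φ⁴` measure** (Glimm–Jaffe 1987, Thm 4.1.1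
applied to `dμ_x = e^{−gφ⁴−κφ²} dφ` and the nearest-neighbour ferromagnet, cf. Prop. 4.2.2
and §9.5): for `g > 0`, `J ≥ 0` and every ferromagnetic polynomial `p` in the fields,
`0 ≤ ⟨p(φ)⟩_{G; g,κ,J}`. [cite: GlimmJaffeQP1987, Thm 4.1.1 (p. 56)] -/
theorem integral_eval_phi4Measure_nonneg {g : ℝ} (hg : 0 < g) (κ : ℝ) {J : ℝ} (hJ : 0 ≤ J)
    {p : MvPolynomial V ℝ} (hp : IsFerromagnetic p) :
    0 ≤ ∫ φ, eval φ p ∂(phi4Measure G g κ J) := by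
  rw [integral_phi4Measure]
  refine div_nonneg ?_ (integral_nonneg fun φ => Real.exp_nonneg _)
  have h := griffiths_first (isEvenSitePotential_phi4 hg κ) ((isFerromagnetic_pairPoly G).smul hJ)
    ((hasQuadraticGrowth_pairPoly G).smul hJ) hp
  simpa only [boltzWeight_phi4] using h

/-- **Second Griffiths inequality for the lattice `φ⁴` measure** (Glimm–Jaffe 1987, Thm 4.1.3,
(4.1.11)): for `g > 0`, `J ≥ 0` and ferromagnetic polynomials `p`, `q` in the fields,
`⟨p⟩⟨q⟩ ≤ ⟨pq⟩`. [cite: GlimmJaffeQP1987, Thm 4.1.3 (4.1.11) (pp. 56–57)] -/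
theorem griffiths_second_phi4Measure {g : ℝ} (hg : 0 < g) (κ : ℝ) {J : ℝ} (hJ : 0 ≤ J)
    {p q : MvPolynomial V ℝ} (hp : IsFerromagnetic p) (hq : IsFerromagnetic q) :
    (∫ φ, eval φ p ∂(phi4Measure G g κ J)) * (∫ φ, eval φ q ∂(phi4Measure G g κ J)) ≤
      ∫ φ, eval φ (p * q) ∂(phi4Measure G g κ J) := by
  have h := griffiths_second (isEvenSitePotential_phi4 hg κ) ((isFerromagnetic_pairPoly G).smul hJ)
    ((hasQuadraticGrowth_pairPoly G).smul hJ) hp hq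
  simp only [boltzWeight_phi4] at h
  have hZ := phi4_partitionFunction_pos G hg κ J
  rw [integral_phi4Measure, integral_phi4Measure, integral_phi4Measure, div_mul_div_comm,
    div_le_div_iff₀ (mul_pos hZ hZ) hZ]
  calc (∫ φ, eval φ p * Real.exp (-phi4Action G g κ J φ)) *
        (∫ φ, eval φ q * Real.exp (-phi4Action G g κ J φ)) *
        ∫ φ, Real.exp (-phi4Action G g κ J φ)
      ≤ (∫ φ, eval φ (p * q) * Real.exp (-phi4Action G g κ J φ)) *
          (∫ φ, Real.exp (-phi4Action G g κ J φ)) * ∫ φ, Real.exp (-phi4Action G g κ J φ) :=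
        mul_le_mul_of_nonneg_right h hZ.le
    _ = _ := by ring

/-- **Griffiths monotonicity of `φ⁴` expectations in the coupling** (Glimm–Jaffe 1987,
Prop. 4.2.1): for `g > 0`, `0 ≤ J ≤ J'` and a ferromagnetic polynomial `p`,
`⟨p⟩_{J} ≤ ⟨p⟩_{J'}`. [cite: GlimmJaffeQP1987, Prop. 4.2.1 (p. 57)] -/
theorem integral_eval_phi4Measure_mono {g : ℝ} (hg : 0 < g) (κ : ℝ) {J J' : ℝ} (hJ : 0 ≤ J)
    (hJJ' : J ≤ J') {p : MvPolynomial V ℝ} (hp : IsFerromagnetic p) :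
    ∫ φ, eval φ p ∂(phi4Measure G g κ J) ≤ ∫ φ, eval φ p ∂(phi4Measure G g κ J') := by
  have hU := isEvenSitePotential_phi4 (V := V) hg κ
  have hD : IsFerromagnetic ((J' - J) • pairPoly G) :=
    (isFerromagnetic_pairPoly G).smul (sub_nonneg.2 hJJ')
  have hDq : HasQuadraticGrowth ((J' - J) • pairPoly G) :=
    (hasQuadraticGrowth_pairPoly G).smul (sub_nonneg.2 hJJ')
  have h := griffiths_mono hU ((isFerromagnetic_pairPoly G).smul hJ)
    ((hasQuadraticGrowth_pairPoly G).smul hJ) hD hDq hp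
  have hsum : J • pairPoly G + (J' - J) • pairPoly G = J' • pairPoly G := by
    rw [← add_smul]; congr 1; ring
  rw [hsum] at h
  simp only [boltzWeight_phi4] at h
  rw [integral_phi4Measure, integral_phi4Measure,
    div_le_div_iff₀ (phi4_partitionFunction_pos G hg κ J) (phi4_partitionFunction_pos G hg κ J')]
  exact h

/-! #### Moments and two-point functions -/

omit [DecidableEq V] in
/-- The monomial `φ^A = ∏ₓ X_x^{A x}` is ferromagnetic. [folklore] -/
theorem isFerromagnetic_prod_X_pow (A : V → ℕ) :
    IsFerromagnetic (∏ x, X x ^ A x : MvPolynomial V ℝ) :=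
  IsFerromagnetic.prod _ fun x _ => (IsFerromagnetic.X x).pow _

omit [DecidableEq V] in
/-- `φ^A` evaluates to `∏ₓ φₓ^{A x}`. [folklore] -/
theorem eval_prod_X_pow (A : V → ℕ) (φ : V → ℝ) :
    eval φ (∏ x, X x ^ A x : MvPolynomial V ℝ) = ∏ x, φ x ^ A x := by
  simp [map_prod]

/-- **First Griffiths inequality for `φ⁴` moments**: `0 ≤ ⟨φ^A⟩ = ⟨∏ₓ φₓ^{Aₓ}⟩` for `g > 0`,
`J ≥ 0` (Glimm–Jaffe 1987, Thm 4.1.1, (4.1.9)). [cite: GlimmJaffeQP1987, Thm 4.1.1 (4.1.9) (p. 56)] -/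
theorem phi4_moment_nonneg {g : ℝ} (hg : 0 < g) (κ : ℝ) {J : ℝ} (hJ : 0 ≤ J) (A : V → ℕ) :
    0 ≤ ∫ φ, ∏ x, φ x ^ A x ∂(phi4Measure G g κ J) := by
  simpa only [eval_prod_X_pow] using
    integral_eval_phi4Measure_nonneg G hg κ hJ (isFerromagnetic_prod_X_pow A)

/-- **Second Griffiths inequality for `φ⁴` moments**: `⟨φ^A⟩⟨φ^B⟩ ≤ ⟨φ^{A+B}⟩`
(Glimm–Jaffe 1987, Thm 4.1.3, (4.1.11)). [cite: GlimmJaffeQP1987, Thm 4.1.3 (4.1.11) (pp. 56–57)] -/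
theorem phi4_moment_griffiths_second {g : ℝ} (hg : 0 < g) (κ : ℝ) {J : ℝ} (hJ : 0 ≤ J)
    (A B : V → ℕ) :
    (∫ φ, ∏ x, φ x ^ A x ∂(phi4Measure G g κ J)) * (∫ φ, ∏ x, φ x ^ B x ∂(phi4Measure G g κ J)) ≤
      ∫ φ, ∏ x, φ x ^ (A x + B x) ∂(phi4Measure G g κ J) := by
  have h := griffiths_second_phi4Measure G hg κ hJ (isFerromagnetic_prod_X_pow A)
    (isFerromagnetic_prod_X_pow B)
  simp only [map_mul, eval_prod_X_pow] at h
  simpa only [pow_add, Finset.prod_mul_distrib] using h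

/-- **Monotonicity of `φ⁴` moments in the coupling**: `⟨φ^A⟩_J ≤ ⟨φ^A⟩_{J'}` for
`0 ≤ J ≤ J'` (Glimm–Jaffe 1987, Prop. 4.2.1). [cite: GlimmJaffeQP1987, Prop. 4.2.1 (p. 57)] -/
theorem phi4_moment_mono {g : ℝ} (hg : 0 < g) (κ : ℝ) {J J' : ℝ} (hJ : 0 ≤ J) (hJJ' : J ≤ J')
    (A : V → ℕ) :
    ∫ φ, ∏ x, φ x ^ A x ∂(phi4Measure G g κ J) ≤ ∫ φ, ∏ x, φ x ^ A x ∂(phi4Measure G g κ J') := by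
  simpa only [eval_prod_X_pow] using
    integral_eval_phi4Measure_mono G hg κ hJ hJJ' (isFerromagnetic_prod_X_pow A)

/-- **Positivity of the `φ⁴` two-point function**: `0 ≤ ⟨φ_x φ_y⟩_{G;g,κ,J}` for `g > 0`,
`J ≥ 0` (first Griffiths inequality). [cite: GlimmJaffeQP1987, Thm 4.1.1 (4.1.9) (p. 56)] -/
theorem phi4_twoPoint_nonneg {g : ℝ} (hg : 0 < g) (κ : ℝ) {J : ℝ} (hJ : 0 ≤ J) (x y : V) :
    0 ≤ ∫ φ, φ x * φ y ∂(phi4Measure G g κ J) := by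
  simpa using integral_eval_phi4Measure_nonneg G hg κ hJ
    ((IsFerromagnetic.X x).mul (IsFerromagnetic.X (σ := V) y))

/-- **Monotonicity of the `φ⁴` two-point function in the coupling**: for `0 ≤ J ≤ J'`,
`⟨φ_x φ_y⟩_J ≤ ⟨φ_x φ_y⟩_{J'}` (Glimm–Jaffe 1987, Prop. 4.2.1). [cite: GlimmJaffeQP1987, Prop. 4.2.1 (p. 57)] -/
theorem phi4_twoPoint_mono {g : ℝ} (hg : 0 < g) (κ : ℝ) {J J' : ℝ} (hJ : 0 ≤ J) (hJJ' : J ≤ J')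
    (x y : V) :
    ∫ φ, φ x * φ y ∂(phi4Measure G g κ J) ≤ ∫ φ, φ x * φ y ∂(phi4Measure G g κ J') := by
  simpa using integral_eval_phi4Measure_mono G hg κ hJ hJJ'
    ((IsFerromagnetic.X x).mul (IsFerromagnetic.X (σ := V) y))

/-- **Griffiths' second inequality for `φ⁴` pair products**:
`⟨φ_x φ_y⟩⟨φ_z φ_w⟩ ≤ ⟨φ_x φ_y φ_z φ_w⟩`. [cite: GlimmJaffeQP1987, Thm 4.1.3 (4.1.11) (pp. 56–57)] -/
theorem phi4_twoPoint_mul_twoPoint_le {g : ℝ} (hg : 0 < g) (κ : ℝ) {J : ℝ} (hJ : 0 ≤ J)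
    (x y z w : V) :
    (∫ φ, φ x * φ y ∂(phi4Measure G g κ J)) * (∫ φ, φ z * φ w ∂(phi4Measure G g κ J)) ≤
      ∫ φ, φ x * φ y * (φ z * φ w) ∂(phi4Measure G g κ J) := by
  simpa using griffiths_second_phi4Measure G hg κ hJ
    ((IsFerromagnetic.X x).mul (IsFerromagnetic.X (σ := V) y))
    ((IsFerromagnetic.X z).mul (IsFerromagnetic.X (σ := V) w))

end Phi4

/-! ### The free-boundary `φ⁴` measures on `ℤᵈ` -/

section Zd

open Literature.Probability.LatticeModels

variable (d : ℕ)

/-- The free-boundary finite-volume two-point function of the lattice `φ⁴` model on `ℤᵈ` as an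
integral over the graph measure on `↥Λ`: `⟨φ_x φ_y⟩_Λ = ∫ ψ_x ψ_y dμ_{Λ}` for `x, y ∈ Λ`.
[cite: GlimmJaffeQP1987, §9.5] -/
theorem phi4TwoPointIn_eq_of_mem (Λ : Finset (Site d)) (g κ J : ℝ) {x y : Site d} (hx : x ∈ Λ)
    (hy : y ∈ Λ) :
    phi4TwoPointIn d Λ g κ J x y =
      ∫ ψ, ψ ⟨x, hx⟩ * ψ ⟨y, hy⟩ ∂(phi4Measure (zdGraphIn d Λ) g κ J) := by
  unfold phi4TwoPointIn Literature.Probability.LatticeModels.twoPoint phi4FreeMeasure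
  rw [integral_map (measurable_glueZero Λ).aemeasurable]
  · simp [hx, hy]
  · exact (((measurable_pi_apply x).mul (measurable_pi_apply y)).aestronglyMeasurable)

/-- If one of the points lies outside the volume, the free-boundary two-point function vanishes
(the field is glued with `0` outside `Λ`). [folklore] -/
theorem phi4TwoPointIn_eq_zero_of_not_mem (Λ : Finset (Site d)) (g κ J : ℝ) {x y : Site d}
    (h : x ∉ Λ ∨ y ∉ Λ) : phi4TwoPointIn d Λ g κ J x y = 0 := by
  unfold phi4TwoPointIn Literature.Probability.LatticeModels.twoPoint phi4FreeMeasure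
  rw [integral_map (measurable_glueZero Λ).aemeasurable]
  · rcases h with hx | hy
    · simp [hx]
    · simp [hy]
  · exact (((measurable_pi_apply x).mul (measurable_pi_apply y)).aestronglyMeasurable)

/-- **Positivity of the free-boundary `φ⁴` two-point function on `ℤᵈ`** (first Griffiths
inequality): `0 ≤ ⟨φ_x φ_y⟩_{Λ; g,κ,J}` for `g > 0`, `J ≥ 0`. [cite: GlimmJaffeQP1987, Thm 4.1.1 (4.1.9) (p. 56)] -/
theorem phi4TwoPointIn_nonneg (Λ : Finset (Site d)) {g : ℝ} (hg : 0 < g) (κ : ℝ) {J : ℝ}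
    (hJ : 0 ≤ J) (x y : Site d) : 0 ≤ phi4TwoPointIn d Λ g κ J x y := by
  by_cases hx : x ∈ Λ
  · by_cases hy : y ∈ Λ
    · rw [phi4TwoPointIn_eq_of_mem d Λ g κ J hx hy]
      exact phi4_twoPoint_nonneg _ hg κ hJ _ _
    · rw [phi4TwoPointIn_eq_zero_of_not_mem d Λ g κ J (Or.inr hy)]
  · rw [phi4TwoPointIn_eq_zero_of_not_mem d Λ g κ J (Or.inl hx)]

/-- **Monotonicity of the free-boundary `φ⁴` two-point function in the coupling** (Griffiths'
second inequality, Glimm–Jaffe 1987, Prop. 4.2.1): `⟨φ_x φ_y⟩_{Λ;J} ≤ ⟨φ_x φ_y⟩_{Λ;J'}` for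
`0 ≤ J ≤ J'`. [cite: GlimmJaffeQP1987, Prop. 4.2.1 (p. 57)] -/
theorem phi4TwoPointIn_mono (Λ : Finset (Site d)) {g : ℝ} (hg : 0 < g) (κ : ℝ) {J J' : ℝ}
    (hJ : 0 ≤ J) (hJJ' : J ≤ J') (x y : Site d) :
    phi4TwoPointIn d Λ g κ J x y ≤ phi4TwoPointIn d Λ g κ J' x y := by
  by_cases hx : x ∈ Λ
  · by_cases hy : y ∈ Λ
    · rw [phi4TwoPointIn_eq_of_mem d Λ g κ J hx hy, phi4TwoPointIn_eq_of_mem d Λ g κ J' hx hy]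
      exact phi4_twoPoint_mono _ hg κ hJ hJJ' _ _
    · rw [phi4TwoPointIn_eq_zero_of_not_mem d Λ g κ J (Or.inr hy),
        phi4TwoPointIn_eq_zero_of_not_mem d Λ g κ J' (Or.inr hy)]
  · rw [phi4TwoPointIn_eq_zero_of_not_mem d Λ g κ J (Or.inl hx),
      phi4TwoPointIn_eq_zero_of_not_mem d Λ g κ J' (Or.inl hx)]

end Zd

end Literature.MathematicalPhysics.QuantumLattice
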